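import Mathlib
import Literature.MathematicalPhysics.QuantumFieldTheory.Balaban1983to89.Node00.AveragingSmooth

/-!
# `Balaban1983to89.B11Eq177CriticalFamilyDerivative` — T. Bałaban, *The variational problem and background fields in renormalization group
# method for lattice gauge theories*, Commun. Math. Phys. **102** (1985) 277–309 [Balaban1985Variational], Sect. G pp. 305–307: (174)∕(177) «the
# expansion of 𝓗 begins with the first order term H₁B», (182)–(183) «The functional derivative (δ∕δB)𝓗(B) satisfies a linear equation obtained by
# differentiations of the equations determining 𝓗(B)»; and T. Bałaban, *Large field renormalization. II*, Commun. Math. Phys. **122** (1989) 355–392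
# [Balaban1989LargeFieldII], (1.12) p. 359 «⟨δB′, H_{1,k}J_{k,Z}⟩ + ⟨δB′, H_{1,k}Δ₁H_{1,k}B′⟩ + … = 0» — THE LINEARISED MINIMISER `H₁` IS THE DERIVATIVE OF
# EVERY DIFFERENTIABLE FAMILY OF FIBRE-CRITICAL CONFIGURATIONS, in the TANGENT-FORM currency of `Node00.CriticalOnFibreTangent` (real Fréchet calculus at a
# submersive constraint chart), selection-free; PROVED.

Honest framing: statement-level skeleton of published theorems with citation tags; proofs where landed; nothing here is a claim about the
Yang–Mills mass gap.

Cell `pub-ymgap` (HUMAN RULINGS D-0062 ∕ D-0149), WIDTH SEAT `pub-ymgap-dag-n12-w3` g0 (node N12 = [B15]; key K1⁷ `stmt-QuantumFields-20542`, `--kind proof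
--supports … --as helper`; count-neutral).  Sub-target U2b of plan g77's `W-SEAT-START-LIST.md` v2 §n12 («the LINEARISED MINIMISER H_{1,k} = the derivative of
the (2.12) minimiser family, [15] (172)∕Sect. G, at the NODE 00 objects»).  PDFs held and re-read first-hand for this module:
`paper:balaban1985-cmp102-variational-background` pp. 305–307 (= PDF 29–31), `paper:balaban1989-cmp122-large-field-ii` pp. 357–359 (= PDF 3–5).

THE PRINT.  [15] p. 305: *«The minimal configuration U_k is a (multi-valued) function of the average variables V, U_k = U_k(V). We will show that it is
an analytic function of V in the following sense: if V = V′V₀, V′ small, U₀ = U_k(V₀), and if we fix a gauge condition for U_k(V′V₀)U₀⁻¹, then it is an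
analytic function of B = 1∕i log V′ … The configuration 𝓗 is represented as 𝓗 = 𝓗₁ + H₁B, (174)»*; p. 306: *«This implies that the expansion of 𝓗
begins with the first order term H₁B. (177)»*; p. 307: *«The functional derivative (δ∕δB)𝓗(B) satisfies a linear equation obtained by differentiations of
the equations determining 𝓗(B).»*; (82)–(83) p. 290: *«⟨(δ∕δA′)𝔉(A′), δA′⟩ = 0 (82) holds for all δA′ in the tangent space, that is δA′ satisfying
QδA′ = 0, RD*δA′ = 0 (83)»*; Sect. C (36)–(47) pp. 283–285: `H` is the minimiser of the quadratic form under the LINEARISED averaging constraint.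
[LF-II] p. 359: *«We expand the function with respect to B′ … Now the condition for a critical configuration is the equation
⟨δB′, H_{1,k}J_{k,Z}⟩ + ⟨δB′, H_{1,k}Δ₁H_{1,k}B′⟩ + (∂∕∂B′)V(B′) = 0. (1.12)»* — the Hessian of the value function `B′ ↦ A(U_{k,Z}(exp(iB′)V_k))` at
`B′ = 0` is the pull-back `H_{1,k}*Δ₁H_{1,k}` of the second variation through the linearised minimiser.

WHY THIS CURRENCY.  The SCHEME-level Sect. G is in the tree (`B11Eq174Chart`, `B11Eq177FirstOrder.hasFDerivAt_chartH177_zero` — `H₁ = D𝓗(0)` for the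
contraction chart over abstract complex Banach spaces; `B11Eq183Differentiation`); what the N12 endpoint's (L2) letter `hlead`
(`B15Prop1Thm1GeneralFormShapes` :582) needs is the SAME sentence at the LATTICE objects, where the (2.12) minimiser of record (`Node00.UminOfRecord`, a
measurable selection inside a residual gauge orbit) is NOT a differentiable function of its datum by construction.  This module proves the selection-free
form print actually uses: WHATEVER differentiable family `g ↦ γ g` of configurations one takes, if every member is CRITICAL ON ITS OWN FIBRE in the tangent
form (82)∕(83) (`Node00.CriticalOnFibreTangent.hasDerivAt_wilsonAction4_expChart_of_isCritOnFibre` supplies exactly this at a submersive chart), then its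
derivative at the base point is FORCED: it is the linearised minimiser `H₁` of [15] Sect. C applied to the datum velocity, as soon as the Lagrangian Hessian
`q = D²a − λ₀∘D²Φ` (print's `Δ₁` in the linearising coordinates (47)) is nondegenerate on the tangent space (print: positive — [15] Sect. E lower bound,
[LF-II] (1.9); a LETTER here).  The implicit-function ingredient is a MOVING KERNEL VECTOR built from a right inverse of the onto derivative (no choice of gauge).

WHAT THIS FILE PROVES (theorems only; no `def`, no `instance`, no `sorry`; axioms standard).  §1 ABSTRACT (real normed `E`; finite-dimensional `V`;
any normed parameter space `G`): `exists_rightInverse_of_surjective`, ★ `exists_multiplier_of_surjective` ∕ `multiplier_unique` (Lagrange form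
`Da(x₀) = λ₀ ∘ L` of tangent-criticality at an ONTO `L = DΦ(x₀)`), `exists_movingKernel` (plumbing), ★★ `lagrangeHessian_fderiv_apply_eq_zero`
(DIFFERENTIATING CRITICALITY ALONG THE FAMILY: `q(γ′h, t) = 0` for every `t ∈ ker L` — print's (182)∕(183) «linear equation obtained by differentiation»),
`hasFDerivAt_constraint_comp` (`L ∘ γ′ = (Φ∘γ)′`), ★★★ `fderiv_criticalFamily_eq_linearisedMinimiser` ∕ `…_eq_linearisedMinimiser_fderiv_comp` (if `q` is
nondegenerate on `ker L`, `γ′(g₀) = H₁ ∘ (Φ∘γ)′(g₀)` for ANY `H₁` with `L ∘ H₁ = id`, `q(H₁y, ker L) = 0` — (177) first member ∕ (174), selection-free),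
`existsUnique_linearisedMinimiser` ∕ `exists_linearisedMinimiser_clm` ∕ `linearisedMinimiser_clm_unique` (finite-dimensional `E`: the two linear conditions
define exactly one linear `H₁ : V →L E`), `linearisedMinimiser_isMinOn` (`H₁y` minimises `q(x,x)` on the affine fibre `{Lx = y}` when `q ≥ 0` on `ker L` —
[15] Sect. C's DEFINITION of `H`, (36)–(47)), `hasFDerivAt_value_criticalFamily` (envelope, first order: `D(a∘γ)(g₀) = λ₀ ∘ (Φ∘γ)′(g₀)` — the `⟨δB′, H₁J⟩`
term of (1.12)), `hasFDerivAt_fderiv_comp` (second-order chain rule, plumbing), ★★ `hessian_value_criticalFamily` (envelope, second order: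
`D²(a∘γ)(g₀)[h,h′] = q(γ′h, γ′h′) + λ₀(D²(Φ∘γ)(g₀)[h,h′])` — the «H₁*Δ₁H₁» SHAPE of (1.12); for an affine datum map the last term vanishes),
`fderiv_apply_eq_zero_of_hasDerivAt_smul` (junction: the ray form of `Node00.CriticalOnFibreTangent` ⇒ the `fderiv` tangent form used here).
§2 NODE 00 READING over n07-e's exponential chart `Node00.expChart U₀ X = (b ↦ U₀(b)·exp X(b))`, `X : PBond P j → 𝔰𝔲(N)`: ★ `contDiff_wilsonAction4_expChart`
(`X ↦ A(U₀·exp X)` is `C^ω`: a trace polynomial in the `C^ω` matrix field `Node00.coeField (expChart U₀ X)` and its adjoints), `hasFDerivAt_fderiv_wilsonAction4_expChart`,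
★★★ `fderiv_criticalExpChartFamily_eq_linearisedMinimiser` (§1 at `a := wilsonAction4 ∘ expChart U₀` and ANY `C²` constraint chart `Ψ` with onto derivative
at the base member), ★★ `hessian_wilsonAction4_criticalExpChartFamily` ((1.12)'s shape at the lattice action).
§3 (v1.1, append-only) JUNCTION WITH THE PREDICATES OF RECORD: ★★ `fderiv_wilsonAction4_expChart_apply_eq_zero_of_isCritOnFibre` (n07-e's CURVE-criticality
`Node00.IsCritOnFibre` of the member `U₀·exp X₁` + a strict submersive level-set chart at `X₁` ⇒ the TANGENT-form hypothesis `hcrit` of §1∕§2 at `X₁`),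
★★★ `fderiv_minimiserExpChartFamily_eq_linearisedMinimiser_class6` (a differentiable family of (2.12) MINIMISERS over print's class (6) on the fibres of the
averaging of record, `B15DeterminingSets.IsMinimizer (Node00.avOfRecord F N K) …`, has derivative `H₁ ∘ (Ψ∘X)′` — via `Node00.isCritOnFibre_of_isMinimizer_class6`).
§4 (v1.1, append-only) THE UNCONSTRAINED-CRITICAL BASE (`Da(x₀) = 0`; the flat background `U₀ = 1`): `lagrangeForm_zero_of_fderiv_eq_zero` (`λ₀ = 0`),
`hessian_value_of_fderiv_eq_zero` (`D²(a∘γ) = D²a(x₀)(γ′·, γ′·)` for ANY `C²` family), ★★ `hessian_value_le_secondVariation_of_fderiv_eq_zero` (tangent-critical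
members ⇒ that value is the MINIMUM of `D²a(x₀)` over the linearised fibre of the datum velocity — [10] (1.65)–(1.66)'s DEFINITION of `⟨B′, Δ_k B′⟩`, the left
side of [LF-II] (1.7)), `hessian_nonneg_of_isLocalMin` (second-order necessary condition: the Fréchet Hessian at a local minimum is nonnegative, via Mathlib's
second-derivative test along lines); `isLocalMin_wilsonAction4_expChart_one` ∕ `fderiv_wilsonAction4_expChart_one_eq_zero` ∕
`secondVariation_wilsonAction4_expChart_one_nonneg` (`U₀ = 1` is the minimum of (5): `A ≥ 0 = A(1)`, hence unconstrained-critical with NONNEGATIVE second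
variation — positivity at the flat background DISCHARGED, not assumed), ★★★ `hessian_wilsonAction4_flat_expChartFamily` (the value Hessian along any fibre-critical
chart family through `1` is the second variation of the Wilson action at `1` on `X′h`, minimal over the linearised fibre of the datum velocity — the U2a + U2b ⇒
U2c junction at the flat background, abstract side; no positivity hypothesis).
v1.2 (append-only): `hasDerivAt_deriv_line` ∕ `hasDerivAt_deriv_smul` (second derivative along a line = diagonal of the Fréchet Hessian), ★★
`hasDerivAt_deriv_wilsonAction4_expChart_smul_fderiv` ∕ `deriv_deriv_wilsonAction4_expChart_smul_eq` (the U2a ↔ U2b junction: n12-w2's ray second variation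
`deriv (deriv (s ↦ A(U₀·e^{sX}))) 0` IS `D²(A∘expChart U₀)(0)(X, X)`), `hessian_wilsonAction4_flat_eq_secondVariation` (NIT 2: the first conjunct of the flat ★★★
theorem with its minimal hypotheses), ★★ `fderiv_flatCriticalExpChartFamily_eq` (`H⁰_{1,k}` at the flat background: `λ₀ = 0` discharged, any `H` with the two FLAT
conditions IS the derivative of every tangent-critical chart family through `1`).
v1.3 (append-only; letter (c-1) of the N12 chain, dag-n12-c's split 2026-08-28 00:39Z): §1.7 `linearisedMinimiser_eq_of_conditions`, ★ `linearisedMinimiser_transfer`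
(ANY property proved for an explicitly exhibited operator with the two conditions — e.g. [15] (190)-type decay — holds for `H₁`), `norm_fderiv_criticalFamily_le_of_bound`
(a pointwise bound on such an operator bounds the velocity of every differentiable fibre-critical family), ★ `norm_sub_le_of_approx_conditions` (ROBUST transfer:
`L ∘ H′ = id` exactly and `q`-orthogonality up to `ε‖y‖‖t‖`, with `q` coercive (constant `c`) on `ker L` ⇒ `‖H y − H′ y‖ ≤ (ε∕c)‖y‖`).

HONEST SCOPE — what is NOT claimed.  (i) Dischargeability-neutral: the ONTO letter is n07-e's GAP-STATED(submersion) (its modules 35b–35d build the canonical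
chart of `Node00.avOfRecord` and its surjectivity at small fields — consumed by name when they land, not typed here); the NONDEGENERACY letter is [15] Sect. E's
lower bound ∕ [LF-II] (1.9) at the lattice objects.  From those two letters (and `C²` ∕ `C^ω` data) the implicit function theorem on the Lagrange system
`(x, λ) ↦ (Da(x) − λ∘DΦ(x), Φ(x) − y)` CONSTRUCTS the differentiable (indeed analytic) fibre-critical family through `(x₀, λ₀)` and its local uniqueness — that
EXISTENCE edition is the sibling seat dag-n12-w1's `Literature.Analysis.Calculus.ConstrainedCriticalFamily` (one declarer; consumed here by name in a later
edition, not restated); what then remains NODE 00's theory is only the IDENTIFICATION «the (2.12) minimiser of record at nearby data lies on that branch»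
([15] Thm 1 uniqueness of the minimal orbit ∕ continuity of the selection).  §1.2–§1.5 hold for ANY differentiable fibre-critical family, so they apply to the
constructed family and to the minimiser of record alike.  (ii) The comparison of `q(H₁·, H₁·)` with
`B5Bounds167Lattice.formDk` ([LF-II] (1.7), [10] (1.65)–(1.67)) and the junction to `hlead` are NOT here (W-SEAT-START-LIST v2 §n12 items 2 and 4).  (iii) Real
calculus only; print's analyticity in `B` is the scheme files' business.  Count-neutral; N12 NOT discharged; the YM mass gap (Clay) is NOT proved by any of
this — R4 closes only the conditional finite-𝕋⁴ rung `BalabanLadder.UV`; nothing continuum ∕ OS.  Imports `Node00.AveragingSmooth` (n07-e, p575068; for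
`expChart`, `coeField`, `contDiff_coeField_expChart`) and Mathlib; modifies nothing; 0 kit, 0 lit wants.

## References
* [Balaban1985Variational] T. Bałaban, Commun. Math. Phys. 102 (1985) 277–309: Sect. C (36)–(47) pp. 283–285, (82)–(83) p. 290, Sect. G (170)–(177)
  pp. 305–306, (182)–(183) p. 307, Prop. 9 p. 309.
* [Balaban1989LargeFieldII] T. Bałaban, Commun. Math. Phys. 122 (1989) 355–392: (1.7)–(1.9) p. 358, (1.12)–(1.13) p. 359.
* [Balaban1988Convergent] T. Bałaban, Commun. Math. Phys. 119 (1988) 243–285: (2.12) p. 256 (the variational problem of record).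
* [Balaban1984PropagatorsI] T. Bałaban, Commun. Math. Phys. 95 (1984) 17–40: (1.64)–(1.66) p. 29 (`⟨B, Δ_kB⟩ = ⟨dH_kB, dH_kB⟩`), (1.67) p. 29, and p. 33 next to
  (1.90)–(1.91) («defined as a minimum of the form ½⟨A, Δ_aA⟩ − a⟨B, B⟩ under the conditions QA = B, R∂*A = 0»).  ERRATUM (v1.2, ref-M READ-11 NIT 1): the v1.1
  docstrings of §4 tag this minimisation sentence as «(1.65)–(1.66) p.33»; the printed locators are (1.64)–(1.66) p. 29 for the form and p. 33 ll. 10–12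
  (beside (1.90)–(1.91)) for the minimisation sentence — content unchanged, landed docstrings left byte-identical.
* [Balaban1985RegularSpaces] T. Bałaban, Commun. Math. Phys. 99 (1985) 75–102: (1.7)–(1.9) p. 77 (the class (6)).
-/

noncomputable section

open Filter Topology Set
open scoped Topology

namespace Literature.MathematicalPhysics.QuantumFieldTheory.Balaban1983to89.B11Eq177CriticalFamilyDerivative

/-! ## §1  Abstract: the derivative of a differentiable family of fibre-critical points is the linearised minimiser -/

section Abstract

variable {E V G : Type*} [NormedAddCommGroup E] [NormedSpace ℝ E]
  [NormedAddCommGroup V] [NormedSpace ℝ V] [FiniteDimensional ℝ V]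
  [NormedAddCommGroup G] [NormedSpace ℝ G]

/-! ### §1.1  Right inverse of the onto linearised constraint; the Lagrange form of tangent-criticality -/

/-- A continuous linear map ONTO a finite-dimensional space has a continuous linear right inverse (print: the linearised averaging `Q` is onto and
`H` ∕ `Q*(QQ*)⁻¹` are right inverses, Sect. C (36)–(47)). [cite: Balaban1985Variational, (36)–(47) pp.283–285 (bookkeeping)] -/
theorem exists_rightInverse_of_surjective (L : E →L[ℝ] V) (hL : Function.Surjective L) :
    ∃ R : V →L[ℝ] E, L.comp R = ContinuousLinearMap.id ℝ V :=
  L.exists_rightInverse_of_surjective (LinearMap.range_eq_top.2 hL)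

/-- **THE LAGRANGE FORM OF TANGENT-CRITICALITY (82)∕(83)**: a functional `φ` (print: `δA′ ↦ ⟨(δ∕δA′)𝔉, δA′⟩`) vanishing on the kernel of an ONTO
`L` (print: the linearised constraint `Q`, `RD*`) factors as `φ = λ₀ ∘ L`. [cite: Balaban1985Variational, (82)–(83) p.290, (170)–(171) p.305] -/
theorem exists_multiplier_of_surjective (φ : E →L[ℝ] ℝ) (L : E →L[ℝ] V) (hL : Function.Surjective L)
    (hφ : ∀ t, L t = 0 → φ t = 0) : ∃ lam : V →L[ℝ] ℝ, φ = lam.comp L := by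
  obtain ⟨R, hR⟩ := exists_rightInverse_of_surjective L hL
  refine ⟨φ.comp R, ?_⟩
  ext x
  have hRL : L (R (L x)) = L x := by
    have := congrArg (fun T : V →L[ℝ] V => T (L x)) hR
    simpa using this
  have hx : L (x - R (L x)) = 0 := by rw [map_sub, hRL, sub_self]
  have h0 := hφ _ hx
  rw [map_sub, sub_eq_zero] at h0
  simpa using h0

omit [FiniteDimensional ℝ V] in
/-- The multiplier of an onto `L` is unique. [cite: Balaban1985Variational, (82)–(83) p.290 (bookkeeping)] -/
theorem multiplier_unique {φ : E →L[ℝ] ℝ} {L : E →L[ℝ] V} (hL : Function.Surjective L) {lam lam' : V →L[ℝ] ℝ}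
    (h : φ = lam.comp L) (h' : φ = lam'.comp L) : lam = lam' := by
  ext y
  obtain ⟨x, rfl⟩ := hL y
  have := congrArg (fun ψ : E →L[ℝ] ℝ => ψ x) (h.symm.trans h')
  simpa using this

/-! ### §1.2  Differentiating criticality along the family: the moving kernel vector and the linear equation (182)∕(183) -/

/-- **MOVING KERNEL VECTOR** (plumbing for the implicit-function step): along a family `γ` differentiable at `g₀` with `γ g₀ = x₀`, every kernel vector `t`
of the onto `DΦ(x₀)` extends to a map `g ↦ τ g`, differentiable at `g₀`, `τ g₀ = t`, with `τ g ∈ ker DΦ(γ g)` for `g` near `g₀`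
(`τ g = t − R (DΦ(γ g)R)⁻¹ DΦ(γ g) t` with `R` a right inverse of `DΦ(x₀)`). [cite: Balaban1985Variational, (182)–(183) p.307 (bookkeeping)] -/
theorem exists_movingKernel {Φ : E → V} {γ : G → E} {g₀ : G} {x₀ : E} (hγ₀ : γ g₀ = x₀)
    {γ' : G →L[ℝ] E} (hγ : HasFDerivAt γ γ' g₀)
    {Φ₂ : E →L[ℝ] E →L[ℝ] V} (hΦ₂ : HasFDerivAt (fun x => fderiv ℝ Φ x) Φ₂ x₀)
    (hsurj : Function.Surjective (fderiv ℝ Φ x₀)) (t : E) (ht : fderiv ℝ Φ x₀ t = 0) :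
    ∃ τ : G → E, τ g₀ = t ∧ DifferentiableAt ℝ τ g₀ ∧ ∀ᶠ g in 𝓝 g₀, fderiv ℝ Φ (γ g) (τ g) = 0 := by
  obtain ⟨R, hR⟩ := exists_rightInverse_of_surjective (fderiv ℝ Φ x₀) hsurj
  have hMd : HasFDerivAt (fun g => fderiv ℝ Φ (γ g)) (Φ₂.comp γ') g₀ := by
    have h1 : HasFDerivAt (fun x => fderiv ℝ Φ x) Φ₂ (γ g₀) := by rw [hγ₀]; exact hΦ₂
    exact h1.comp g₀ hγ
  have hN₀ : (fderiv ℝ Φ (γ g₀)).comp R = 1 := by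
    rw [hγ₀, hR]; rfl
  have hNd : DifferentiableAt ℝ (fun g => (fderiv ℝ Φ (γ g)).comp R) g₀ :=
    hMd.differentiableAt.clm_comp (differentiableAt_const R)
  have hNunit : ∀ᶠ g in 𝓝 g₀, IsUnit ((fderiv ℝ Φ (γ g)).comp R) := by
    have hc : ContinuousAt (fun g => (fderiv ℝ Φ (γ g)).comp R) g₀ := hNd.continuousAt
    have ho : IsOpen {T : V →L[ℝ] V | IsUnit T} := Units.isOpen
    refine hc.preimage_mem_nhds (ho.mem_nhds ?_)
    rw [Set.mem_setOf_eq, hN₀]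
    exact isUnit_one
  refine ⟨fun g => t - R (Ring.inverse ((fderiv ℝ Φ (γ g)).comp R) (fderiv ℝ Φ (γ g) t)), ?_, ?_, ?_⟩
  · have h0 : fderiv ℝ Φ (γ g₀) t = 0 := by rw [hγ₀, ht]
    simp only [h0, map_zero, sub_zero]
  · have h1 : DifferentiableAt ℝ (fun g => Ring.inverse ((fderiv ℝ Φ (γ g)).comp R)) g₀ :=
      hNd.inverse (by rw [hN₀]; exact isUnit_one)
    have h2 : DifferentiableAt ℝ (fun g => fderiv ℝ Φ (γ g) t) g₀ :=
      hMd.differentiableAt.clm_apply (differentiableAt_const t)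
    have h3 : DifferentiableAt ℝ (fun g => Ring.inverse ((fderiv ℝ Φ (γ g)).comp R) (fderiv ℝ Φ (γ g) t)) g₀ :=
      h1.clm_apply h2
    exact (differentiableAt_const t).sub (R.differentiableAt.comp g₀ h3)
  · filter_upwards [hNunit] with g hg
    have hRN : ∀ v, fderiv ℝ Φ (γ g) (R v) = ((fderiv ℝ Φ (γ g)).comp R) v := fun v => rfl
    have hmul : ((fderiv ℝ Φ (γ g)).comp R) (Ring.inverse ((fderiv ℝ Φ (γ g)).comp R) (fderiv ℝ Φ (γ g) t))
        = (((fderiv ℝ Φ (γ g)).comp R) * Ring.inverse ((fderiv ℝ Φ (γ g)).comp R)) (fderiv ℝ Φ (γ g) t) := rfl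
    rw [map_sub, hRN, hmul, Ring.mul_inverse_cancel _ hg]
    exact sub_self _

/-- ★★ **DIFFERENTIATING CRITICALITY ALONG THE FAMILY** ([15] p. 307 «a linear equation obtained by differentiations of the equations determining
𝓗(B)», (182)–(183); [LF-II] (1.12)): let `a` (the action in a chart) and `Φ` (the constraint chart) have second derivatives `a₂`, `Φ₂` at `x₀` (in the
sense `HasFDerivAt (fderiv a) a₂ x₀`), `DΦ(x₀)` ONTO, `Da(x₀) = λ₀ ∘ DΦ(x₀)` (the Lagrange form, `exists_multiplier_of_surjective`), and let `g ↦ γ g` be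
ANY family differentiable at `g₀`, `γ g₀ = x₀`, whose members are TANGENT-CRITICAL on their own fibres near `g₀` (`Da(γ g)` kills `ker DΦ(γ g)` — (82) on
(83)).  Then for every direction `h` and every `t ∈ ker DΦ(x₀)`: `a₂(γ′h)(t) − λ₀(Φ₂(γ′h)(t)) = 0` — the velocity `γ′h` is `q`-orthogonal to the tangent
space, `q := a₂ − λ₀∘Φ₂` the Hessian of the Lagrangian (print's `Δ₁` in the linearising coordinates (47)).
[cite: Balaban1985Variational, (182)–(183) p.307, (82)–(83) p.290, (47) p.285; Balaban1989LargeFieldII, (1.12) p.359] -/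
theorem lagrangeHessian_fderiv_apply_eq_zero {a : E → ℝ} {Φ : E → V} {γ : G → E} {g₀ : G} {x₀ : E}
    (hγ₀ : γ g₀ = x₀) {γ' : G →L[ℝ] E} (hγ : HasFDerivAt γ γ' g₀)
    {a₂ : E →L[ℝ] E →L[ℝ] ℝ} (ha₂ : HasFDerivAt (fun x => fderiv ℝ a x) a₂ x₀)
    {Φ₂ : E →L[ℝ] E →L[ℝ] V} (hΦ₂ : HasFDerivAt (fun x => fderiv ℝ Φ x) Φ₂ x₀)
    (hsurj : Function.Surjective (fderiv ℝ Φ x₀))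
    {lam : V →L[ℝ] ℝ} (hlam : fderiv ℝ a x₀ = lam.comp (fderiv ℝ Φ x₀))
    (hcrit : ∀ᶠ g in 𝓝 g₀, ∀ t, fderiv ℝ Φ (γ g) t = 0 → fderiv ℝ a (γ g) t = 0)
    (h : G) {t : E} (ht : fderiv ℝ Φ x₀ t = 0) :
    a₂ (γ' h) t - lam (Φ₂ (γ' h) t) = 0 := by
  obtain ⟨τ, hτ₀, hτd, hτker⟩ := exists_movingKernel hγ₀ hγ hΦ₂ hsurj t ht
  have hτ : HasFDerivAt τ (fderiv ℝ τ g₀) g₀ := hτd.hasFDerivAt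
  have hMa : HasFDerivAt (fun g => fderiv ℝ a (γ g)) (a₂.comp γ') g₀ := by
    have h1 : HasFDerivAt (fun x => fderiv ℝ a x) a₂ (γ g₀) := by rw [hγ₀]; exact ha₂
    exact h1.comp g₀ hγ
  have hMΦ : HasFDerivAt (fun g => fderiv ℝ Φ (γ g)) (Φ₂.comp γ') g₀ := by
    have h1 : HasFDerivAt (fun x => fderiv ℝ Φ x) Φ₂ (γ g₀) := by rw [hγ₀]; exact hΦ₂
    exact h1.comp g₀ hγ
  -- the two composite functions `g ↦ Da(γ g)(τ g)` and `g ↦ DΦ(γ g)(τ g)` vanish near `g₀`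
  have hFa0 : (fun g => fderiv ℝ a (γ g) (τ g)) =ᶠ[𝓝 g₀] fun _ => (0 : ℝ) := by
    filter_upwards [hcrit, hτker] with g hc hk using hc _ hk
  have hFΦ0 : (fun g => fderiv ℝ Φ (γ g) (τ g)) =ᶠ[𝓝 g₀] fun _ => (0 : V) := hτker
  have hFa : HasFDerivAt (fun g => fderiv ℝ a (γ g) (τ g)) ((fderiv ℝ a (γ g₀)).comp (fderiv ℝ τ g₀) + (a₂.comp γ').flip (τ g₀)) g₀ :=
    hMa.clm_apply hτ
  have hFΦ : HasFDerivAt (fun g => fderiv ℝ Φ (γ g) (τ g)) ((fderiv ℝ Φ (γ g₀)).comp (fderiv ℝ τ g₀) + (Φ₂.comp γ').flip (τ g₀)) g₀ :=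
    hMΦ.clm_apply hτ
  have hza : (fderiv ℝ a (γ g₀)).comp (fderiv ℝ τ g₀) + (a₂.comp γ').flip (τ g₀) = 0 :=
    hFa.unique ((hasFDerivAt_const (0 : ℝ) g₀).congr_of_eventuallyEq hFa0)
  have hzΦ : (fderiv ℝ Φ (γ g₀)).comp (fderiv ℝ τ g₀) + (Φ₂.comp γ').flip (τ g₀) = 0 :=
    hFΦ.unique ((hasFDerivAt_const (0 : V) g₀).congr_of_eventuallyEq hFΦ0)
  have e1 := congrArg (fun T : G →L[ℝ] ℝ => T h) hza
  have e2 := congrArg (fun T : G →L[ℝ] V => T h) hzΦ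
  simp only [add_apply, ContinuousLinearMap.comp_apply, ContinuousLinearMap.flip_apply,
    zero_apply, hγ₀, hτ₀] at e1 e2
  -- `Da(x₀)(τ′h) = λ₀(DΦ(x₀)(τ′h)) = −λ₀(Φ₂(γ′h) t)`
  have e3 : fderiv ℝ a x₀ (fderiv ℝ τ g₀ h) = lam (fderiv ℝ Φ x₀ (fderiv ℝ τ g₀ h)) := by
    rw [hlam]; rfl
  have e4 : fderiv ℝ Φ x₀ (fderiv ℝ τ g₀ h) = -Φ₂ (γ' h) t := eq_neg_of_add_eq_zero_left e2
  rw [e3, e4, map_neg] at e1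
  linarith

omit [FiniteDimensional ℝ V] in
/-- The linearised constraint of the velocity is the datum velocity: `DΦ(x₀)(γ′h) = (Φ∘γ)′(g₀)h` (chain rule; print: `Q(H₁B) = B`, (36)).
[cite: Balaban1985Variational, (36) p.283, (174) p.305 (bookkeeping)] -/
theorem hasFDerivAt_constraint_comp {Φ : E → V} {γ : G → E} {g₀ : G} {x₀ : E} (hγ₀ : γ g₀ = x₀)
    {γ' : G →L[ℝ] E} (hγ : HasFDerivAt γ γ' g₀) (hΦ : DifferentiableAt ℝ Φ x₀) :
    HasFDerivAt (fun g => Φ (γ g)) ((fderiv ℝ Φ x₀).comp γ') g₀ := by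
  have h1 : HasFDerivAt Φ (fderiv ℝ Φ x₀) (γ g₀) := by rw [hγ₀]; exact hΦ.hasFDerivAt
  exact h1.comp g₀ hγ

/-! ### §1.3  `H₁` IS the derivative: uniqueness under nondegeneracy of the Lagrangian Hessian on the tangent space -/

/-- ★★★ **THE LINEARISED MINIMISER IS THE DERIVATIVE OF EVERY DIFFERENTIABLE FIBRE-CRITICAL FAMILY** ((177) first member «the expansion of 𝓗 begins
with the first order term H₁B»; (174) `𝓗 = 𝓗₁ + H₁B`): in the situation of `lagrangeHessian_fderiv_apply_eq_zero`, if the Lagrangian Hessian `q = a₂ − λ₀∘Φ₂`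
is NONDEGENERATE on `ker DΦ(x₀)` (print: positive definite — [15] Sect. E, [LF-II] (1.9); a letter), then for ANY map `H₁ : V → E` satisfying the two
defining conditions of [15] Sect. C — `DΦ(x₀)(H₁y) = y` (linearised constraint) and `q(H₁y, t) = 0` for `t ∈ ker DΦ(x₀)` (minimisation ∕ `q`-orthogonality)
— the velocity of the family is `γ′(g₀)h = H₁(DΦ(x₀)(γ′h))`, whatever the selection `γ`.
[cite: Balaban1985Variational, (174) p.305, (177) p.306, (36)–(47) pp.283–285, (182)–(183) p.307; Balaban1989LargeFieldII, (1.12)–(1.13) p.359] -/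
theorem fderiv_criticalFamily_eq_linearisedMinimiser {a : E → ℝ} {Φ : E → V} {γ : G → E} {g₀ : G} {x₀ : E}
    (hγ₀ : γ g₀ = x₀) {γ' : G →L[ℝ] E} (hγ : HasFDerivAt γ γ' g₀)
    {a₂ : E →L[ℝ] E →L[ℝ] ℝ} (ha₂ : HasFDerivAt (fun x => fderiv ℝ a x) a₂ x₀)
    {Φ₂ : E →L[ℝ] E →L[ℝ] V} (hΦ₂ : HasFDerivAt (fun x => fderiv ℝ Φ x) Φ₂ x₀)
    (hsurj : Function.Surjective (fderiv ℝ Φ x₀))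
    {lam : V →L[ℝ] ℝ} (hlam : fderiv ℝ a x₀ = lam.comp (fderiv ℝ Φ x₀))
    (hcrit : ∀ᶠ g in 𝓝 g₀, ∀ t, fderiv ℝ Φ (γ g) t = 0 → fderiv ℝ a (γ g) t = 0)
    (hnd : ∀ d, fderiv ℝ Φ x₀ d = 0 → (∀ t, fderiv ℝ Φ x₀ t = 0 → a₂ d t - lam (Φ₂ d t) = 0) → d = 0)
    {H : V → E} (hLH : ∀ y, fderiv ℝ Φ x₀ (H y) = y)
    (hH : ∀ y t, fderiv ℝ Φ x₀ t = 0 → a₂ (H y) t - lam (Φ₂ (H y) t) = 0)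
    (h : G) : γ' h = H (fderiv ℝ Φ x₀ (γ' h)) := by
  have hd : fderiv ℝ Φ x₀ (γ' h - H (fderiv ℝ Φ x₀ (γ' h))) = 0 := by
    rw [map_sub, hLH, sub_self]
  have hzero := hnd _ hd (fun t ht => by
    have e1 := lagrangeHessian_fderiv_apply_eq_zero hγ₀ hγ ha₂ hΦ₂ hsurj hlam hcrit h ht
    have e2 := hH (fderiv ℝ Φ x₀ (γ' h)) t ht
    simp only [map_sub, sub_apply]
    linarith)
  exact sub_eq_zero.1 hzero

/-- The same with the datum velocity written as the derivative of the datum map `Φ ∘ γ`: `γ′(g₀)h = H₁((Φ∘γ)′(g₀)h)` — for print's datum `B′` itself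
(`Φ∘γ = id` in the coordinates `B′`) this reads `γ′(0) = H₁`, i.e. (177)'s «H₁B». [cite: Balaban1985Variational, (177) p.306, (174) p.305] -/
theorem fderiv_criticalFamily_eq_linearisedMinimiser_fderiv_comp {a : E → ℝ} {Φ : E → V} {γ : G → E} {g₀ : G} {x₀ : E}
    (hγ₀ : γ g₀ = x₀) {γ' : G →L[ℝ] E} (hγ : HasFDerivAt γ γ' g₀) (hΦ : DifferentiableAt ℝ Φ x₀)
    {a₂ : E →L[ℝ] E →L[ℝ] ℝ} (ha₂ : HasFDerivAt (fun x => fderiv ℝ a x) a₂ x₀)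
    {Φ₂ : E →L[ℝ] E →L[ℝ] V} (hΦ₂ : HasFDerivAt (fun x => fderiv ℝ Φ x) Φ₂ x₀)
    (hsurj : Function.Surjective (fderiv ℝ Φ x₀))
    {lam : V →L[ℝ] ℝ} (hlam : fderiv ℝ a x₀ = lam.comp (fderiv ℝ Φ x₀))
    (hcrit : ∀ᶠ g in 𝓝 g₀, ∀ t, fderiv ℝ Φ (γ g) t = 0 → fderiv ℝ a (γ g) t = 0)
    (hnd : ∀ d, fderiv ℝ Φ x₀ d = 0 → (∀ t, fderiv ℝ Φ x₀ t = 0 → a₂ d t - lam (Φ₂ d t) = 0) → d = 0)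
    {H : V → E} (hLH : ∀ y, fderiv ℝ Φ x₀ (H y) = y)
    (hH : ∀ y t, fderiv ℝ Φ x₀ t = 0 → a₂ (H y) t - lam (Φ₂ (H y) t) = 0)
    (h : G) : γ' h = H (fderiv ℝ (fun g => Φ (γ g)) g₀ h) := by
  rw [(hasFDerivAt_constraint_comp hγ₀ hγ hΦ).fderiv, ContinuousLinearMap.comp_apply]
  exact fderiv_criticalFamily_eq_linearisedMinimiser hγ₀ hγ ha₂ hΦ₂ hsurj hlam hcrit hnd hLH hH h

/-! ### §1.4  The linearised minimiser as an object: existence, uniqueness, linearity; the minimisation reading of [15] Sect. C -/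

omit [FiniteDimensional ℝ V] in
/-- **THE TWO LINEAR CONDITIONS DEFINE EXACTLY ONE VECTOR** (finite-dimensional configuration space): for an onto `L` and a bilinear `q` nondegenerate on
`ker L`, every datum `y` has exactly one `x` with `Lx = y` and `q(x, ker L) = 0` — the value `H₁y`. [cite: Balaban1985Variational, (36)–(47) pp.283–285] -/
theorem existsUnique_linearisedMinimiser [FiniteDimensional ℝ E] (L : E →L[ℝ] V) (hL : Function.Surjective L) (q : E →L[ℝ] E →L[ℝ] ℝ)
    (hnd : ∀ d, L d = 0 → (∀ t, L t = 0 → q d t = 0) → d = 0) (y : V) :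
    ∃! x : E, L x = y ∧ ∀ t, L t = 0 → q x t = 0 := by
  classical
  -- the kernel `T` and the restricted form `ρ : T → Dual T`
  set T : Submodule ℝ E := LinearMap.ker (L : E →ₗ[ℝ] V) with hT
  have hmemT : ∀ {t : E}, t ∈ T ↔ L t = 0 := fun {t} => by rw [hT, LinearMap.mem_ker]; rfl
  let ρ : T →ₗ[ℝ] Module.Dual ℝ T :=
    LinearMap.mk₂ ℝ (fun d t : T => q (d : E) (t : E))
      (fun d₁ d₂ t => by simp only [Submodule.coe_add, map_add, add_apply])
      (fun c d t => by simp only [Submodule.coe_smul, map_smul, smul_apply])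
      (fun d t₁ t₂ => by simp only [Submodule.coe_add, map_add])
      (fun c d t => by simp only [Submodule.coe_smul, map_smul])
  have hρinj : Function.Injective ρ := by
    intro d₁ d₂ h12
    have hsub : ρ (d₁ - d₂) = 0 := by rw [map_sub, h12, sub_self]
    have hd : ((d₁ - d₂ : T) : E) = 0 := by
      refine hnd _ (hmemT.1 (d₁ - d₂).2) (fun t ht => ?_)
      have := LinearMap.congr_fun hsub ⟨t, hmemT.2 ht⟩
      simpa [ρ] using this
    have : d₁ - d₂ = 0 := Subtype.ext (by simpa using hd)
    exact sub_eq_zero.1 this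
  have hρsurj : Function.Surjective ρ :=
    (LinearMap.injective_iff_surjective_of_finrank_eq_finrank (Subspace.dual_finrank_eq).symm).1 hρinj
  -- existence
  obtain ⟨x₀, hx₀⟩ := hL y
  let f₀ : Module.Dual ℝ T :=
    { toFun := fun t => -q x₀ (t : E)
      map_add' := fun t₁ t₂ => by simp only [Submodule.coe_add, map_add, neg_add]
      map_smul' := fun c t => by simp only [Submodule.coe_smul, map_smul, smul_eq_mul, RingHom.id_apply, mul_neg] }
  obtain ⟨d, hd⟩ := hρsurj f₀
  refine ⟨x₀ + (d : E), ⟨?_, fun t ht => ?_⟩, ?_⟩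
  · rw [map_add, hx₀, show L (d : E) = 0 from hmemT.1 d.2, add_zero]
  · have := LinearMap.congr_fun hd ⟨t, hmemT.2 ht⟩
    simp only [ρ, f₀, LinearMap.mk₂_apply, LinearMap.coe_mk, AddHom.coe_mk] at this
    rw [map_add, add_apply, this, add_neg_cancel]
  · -- uniqueness
    rintro x' ⟨hLx', hqx'⟩
    have hdiff : L (x' - (x₀ + (d : E))) = 0 := by
      rw [map_sub, hLx', map_add, hx₀, show L (d : E) = 0 from hmemT.1 d.2, add_zero, sub_self]
    have hx0d : ∀ t, L t = 0 → q (x₀ + (d : E)) t = 0 := fun t ht => by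
      have := LinearMap.congr_fun hd ⟨t, hmemT.2 ht⟩
      simp only [ρ, f₀, LinearMap.mk₂_apply, LinearMap.coe_mk, AddHom.coe_mk] at this
      rw [map_add, add_apply, this, add_neg_cancel]
    have := hnd _ hdiff (fun t ht => by
      rw [map_sub, sub_apply, hqx' t ht, hx0d t ht, sub_self])
    exact sub_eq_zero.1 this

/-- **`H₁` AS A CONTINUOUS LINEAR MAP** (finite-dimensional case): there is `H₁ : V →L E` with `L ∘ H₁ = id` and `q(H₁y, ker L) = 0` for all `y` — the
operator `H` of [15] (45)–(47) in the abstract; linear by uniqueness. [cite: Balaban1985Variational, (45)–(47) p.285, (174) p.305] -/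
theorem exists_linearisedMinimiser_clm [FiniteDimensional ℝ E] (L : E →L[ℝ] V) (hL : Function.Surjective L) (q : E →L[ℝ] E →L[ℝ] ℝ)
    (hnd : ∀ d, L d = 0 → (∀ t, L t = 0 → q d t = 0) → d = 0) :
    ∃ H : V →L[ℝ] E, (∀ y, L (H y) = y) ∧ ∀ y t, L t = 0 → q (H y) t = 0 := by
  classical
  have hEU := existsUnique_linearisedMinimiser L hL q hnd
  let H₀ : V → E := fun y => (hEU y).choose
  have hspec : ∀ y, L (H₀ y) = y ∧ ∀ t, L t = 0 → q (H₀ y) t = 0 := fun y => (hEU y).choose_spec.1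
  have huniq : ∀ y x, (L x = y ∧ ∀ t, L t = 0 → q x t = 0) → x = H₀ y := fun y x hx => (hEU y).unique hx (hspec y)
  have hadd : ∀ y y', H₀ (y + y') = H₀ y + H₀ y' := fun y y' => by
    refine (huniq (y + y') _ ⟨?_, fun t ht => ?_⟩).symm
    · rw [map_add, (hspec y).1, (hspec y').1]
    · rw [map_add, add_apply, (hspec y).2 t ht, (hspec y').2 t ht, add_zero]
  have hsmul : ∀ (c : ℝ) y, H₀ (c • y) = c • H₀ y := fun c y => by
    refine (huniq (c • y) _ ⟨?_, fun t ht => ?_⟩).symm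
    · rw [map_smul, (hspec y).1]
    · rw [map_smul, smul_apply, (hspec y).2 t ht, smul_zero]
  let Hl : V →ₗ[ℝ] E := { toFun := H₀, map_add' := hadd, map_smul' := hsmul }
  refine ⟨LinearMap.toContinuousLinearMap Hl, fun y => (hspec y).1, fun y t ht => (hspec y).2 t ht⟩

omit [FiniteDimensional ℝ V] in
/-- Any two maps satisfying the two defining conditions agree (so every `H₁` of the previous theorems is THE linearised minimiser).
[cite: Balaban1985Variational, (45)–(47) p.285 (bookkeeping)] -/
theorem linearisedMinimiser_unique (L : E →L[ℝ] V) (q : E →L[ℝ] E →L[ℝ] ℝ)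
    (hnd : ∀ d, L d = 0 → (∀ t, L t = 0 → q d t = 0) → d = 0) {H H' : V → E}
    (hLH : ∀ y, L (H y) = y) (hH : ∀ y t, L t = 0 → q (H y) t = 0)
    (hLH' : ∀ y, L (H' y) = y) (hH' : ∀ y t, L t = 0 → q (H' y) t = 0) (y : V) : H y = H' y := by
  have hd : L (H y - H' y) = 0 := by rw [map_sub, hLH, hLH', sub_self]
  exact sub_eq_zero.1 (hnd _ hd (fun t ht => by rw [map_sub, sub_apply, hH y t ht, hH' y t ht, sub_self]))

omit [FiniteDimensional ℝ V] in
/-- Positivity on the tangent space gives nondegeneracy there (print's hypothesis form: «the operator … is positive, hence invertible on this subspace»,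
[LF-II] p. 359). [cite: Balaban1989LargeFieldII, (1.9) p.358, p.359; Balaban1985Variational, Sect. E p.300] -/
theorem nondegenerate_of_pos (L : E →L[ℝ] V) (q : E →L[ℝ] E →L[ℝ] ℝ) (hpos : ∀ t, L t = 0 → t ≠ 0 → 0 < q t t)
    (d : E) (hd : L d = 0) (hq : ∀ t, L t = 0 → q d t = 0) : d = 0 := by
  by_contra hne
  have := hpos d hd hne
  rw [hq d hd] at this
  exact lt_irrefl _ this

omit [FiniteDimensional ℝ V] in
/-- **THE MINIMISATION READING ([15] Sect. C (36): «H B is the minimizer of the quadratic form under the constraint»)**: if `q` is symmetric and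
nonnegative on `ker L`, a vector `x` that is `q`-orthogonal to `ker L` minimises `x′ ↦ q(x′, x′)` on its affine fibre `{Lx′ = Lx}`:
`q(x′,x′) = q(x,x) + q(x′ − x, x′ − x) ≥ q(x,x)`. [cite: Balaban1985Variational, (36)–(37) p.283, (45)–(47) p.285] -/
theorem linearisedMinimiser_isMinOn (L : E →L[ℝ] V) (q : E →L[ℝ] E →L[ℝ] ℝ) (hsym : ∀ u v, q u v = q v u)
    (hpos : ∀ t, L t = 0 → 0 ≤ q t t) {x : E} (hx : ∀ t, L t = 0 → q x t = 0) {x' : E} (hx' : L x' = L x) :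
    q x x ≤ q x' x' := by
  have ht : L (x' - x) = 0 := by rw [map_sub, hx', sub_self]
  have hdecomp : q x' x' = q x x + q (x' - x) (x' - x) := by
    have e : x' = x + (x' - x) := by abel
    conv_lhs => rw [e]
    simp only [map_add, add_apply, hx _ ht, hsym (x' - x) x]
    ring
  rw [hdecomp]
  linarith [hpos _ ht]

/-! ### §1.5  The value function along the family: envelope to first and second order — the shape of (1.12) -/

omit [FiniteDimensional ℝ V] in
/-- **ENVELOPE, FIRST ORDER** (the `⟨δB′, H_{1,k}J⟩` term of (1.12); [15] §4 of `B11Eq177FirstOrder` at the scheme level): with the Lagrange form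
`Da(x₀) = λ₀ ∘ DΦ(x₀)`, the value `g ↦ a(γ g)` has derivative `λ₀ ∘ (Φ∘γ)′(g₀)` at `g₀` — it sees the family only through the datum map.
[cite: Balaban1989LargeFieldII, (1.12) p.359; Balaban1985Variational, (81) p.290, (174)–(177) pp.305–306] -/
theorem hasFDerivAt_value_criticalFamily {a : E → ℝ} {Φ : E → V} {γ : G → E} {g₀ : G} {x₀ : E} (hγ₀ : γ g₀ = x₀)
    {γ' : G →L[ℝ] E} (hγ : HasFDerivAt γ γ' g₀) (ha : DifferentiableAt ℝ a x₀) (hΦ : DifferentiableAt ℝ Φ x₀)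
    {lam : V →L[ℝ] ℝ} (hlam : fderiv ℝ a x₀ = lam.comp (fderiv ℝ Φ x₀)) :
    HasFDerivAt (fun g => a (γ g)) (lam.comp (fderiv ℝ (fun g => Φ (γ g)) g₀)) g₀ := by
  have h1 : HasFDerivAt a (fderiv ℝ a x₀) (γ g₀) := by rw [hγ₀]; exact ha.hasFDerivAt
  have h2 : HasFDerivAt (fun g => a (γ g)) ((fderiv ℝ a x₀).comp γ') g₀ := h1.comp g₀ hγ
  rw [(hasFDerivAt_constraint_comp hγ₀ hγ hΦ).fderiv, ← ContinuousLinearMap.comp_assoc, ← hlam]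
  exact h2

/-- **SECOND-ORDER CHAIN RULE** (plumbing): if `f` has second derivative `f₂` at `x₀ = γ g₀` and `γ` has second derivative `γ₂` at `g₀`, both being
differentiable nearby, then `g ↦ D(f∘γ)(g)` has derivative `h ↦ Df(x₀) ∘ γ₂h + f₂(γ′h) ∘ γ′` at `g₀`; applied: `D²(f∘γ)(g₀)[h][h′] = Df(x₀)(γ₂ h h′) + f₂(γ′h)(γ′h′)`.
[cite: Balaban1985Variational, (81) p.290, (174)–(177) pp.305–306 (bookkeeping: expansion of the action along the chart to second order)] -/
theorem hasFDerivAt_fderiv_comp {W : Type*} [NormedAddCommGroup W] [NormedSpace ℝ W] {f : E → W} {γ : G → E} {g₀ : G} {x₀ : E}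
    (hγ₀ : γ g₀ = x₀) {γ' : G →L[ℝ] E} (hγ : HasFDerivAt γ γ' g₀) {γ₂ : G →L[ℝ] G →L[ℝ] E}
    (hγ₂ : HasFDerivAt (fun g => fderiv ℝ γ g) γ₂ g₀) {f₂ : E →L[ℝ] E →L[ℝ] W} (hf₂ : HasFDerivAt (fun x => fderiv ℝ f x) f₂ x₀)
    (hγd : ∀ᶠ g in 𝓝 g₀, DifferentiableAt ℝ γ g) (hfd : ∀ᶠ x in 𝓝 x₀, DifferentiableAt ℝ f x) :
    HasFDerivAt (fun g => fderiv ℝ (fun g => f (γ g)) g)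
      ((ContinuousLinearMap.compL ℝ G E W (fderiv ℝ f x₀)).comp γ₂ +
        ((ContinuousLinearMap.compL ℝ G E W).flip γ').comp (f₂.comp γ')) g₀ := by
  have hc : HasFDerivAt (fun g => fderiv ℝ f (γ g)) (f₂.comp γ') g₀ := by
    have h1 : HasFDerivAt (fun x => fderiv ℝ f x) f₂ (γ g₀) := by rw [hγ₀]; exact hf₂
    exact h1.comp g₀ hγ
  have hprod : HasFDerivAt (fun g => (fderiv ℝ f (γ g)).comp (fderiv ℝ γ g))
      ((ContinuousLinearMap.compL ℝ G E W (fderiv ℝ f (γ g₀))).comp γ₂ +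
        ((ContinuousLinearMap.compL ℝ G E W).flip (fderiv ℝ γ g₀)).comp (f₂.comp γ')) g₀ :=
    hc.clm_comp hγ₂
  rw [hγ₀, hγ.fderiv] at hprod
  -- near `g₀` the chain rule identifies `D(f∘γ)(g)` with the product
  have hfdγ : ∀ᶠ g in 𝓝 g₀, DifferentiableAt ℝ f (γ g) := by
    have hct : Tendsto γ (𝓝 g₀) (𝓝 x₀) := by rw [← hγ₀]; exact hγ.continuousAt
    exact hct.eventually hfd
  have heq : (fun g => fderiv ℝ (fun g => f (γ g)) g) =ᶠ[𝓝 g₀] fun g => (fderiv ℝ f (γ g)).comp (fderiv ℝ γ g) := by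
    filter_upwards [hγd, hfdγ] with g hg hfg
    exact fderiv_comp g hfg hg
  exact hprod.congr_of_eventuallyEq heq

/-- The applied form of the second-order chain rule: `D²(f∘γ)(g₀) h h′ = Df(x₀)(γ₂ h h′) + f₂(γ′h)(γ′h′)`.
[cite: Balaban1985Variational, (81) p.290, (177) p.306 (bookkeeping)] -/
theorem fderiv_fderiv_comp_apply {W : Type*} [NormedAddCommGroup W] [NormedSpace ℝ W] {f : E → W} {γ : G → E} {g₀ : G} {x₀ : E}
    (hγ₀ : γ g₀ = x₀) {γ' : G →L[ℝ] E} (hγ : HasFDerivAt γ γ' g₀) {γ₂ : G →L[ℝ] G →L[ℝ] E}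
    (hγ₂ : HasFDerivAt (fun g => fderiv ℝ γ g) γ₂ g₀) {f₂ : E →L[ℝ] E →L[ℝ] W} (hf₂ : HasFDerivAt (fun x => fderiv ℝ f x) f₂ x₀)
    (hγd : ∀ᶠ g in 𝓝 g₀, DifferentiableAt ℝ γ g) (hfd : ∀ᶠ x in 𝓝 x₀, DifferentiableAt ℝ f x) (h h' : G) :
    fderiv ℝ (fun g => fderiv ℝ (fun g => f (γ g)) g) g₀ h h' = fderiv ℝ f x₀ (γ₂ h h') + f₂ (γ' h) (γ' h') := by
  rw [(hasFDerivAt_fderiv_comp hγ₀ hγ hγ₂ hf₂ hγd hfd).fderiv]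
  simp only [add_apply, ContinuousLinearMap.comp_apply, ContinuousLinearMap.compL_apply,
    ContinuousLinearMap.flip_apply]

omit [FiniteDimensional ℝ V] in
/-- ★★ **ENVELOPE, SECOND ORDER — THE SHAPE OF (1.12)**: along ANY twice-differentiable family `γ` through `x₀` with the Lagrange form `Da(x₀) = λ₀ ∘ DΦ(x₀)`,
the Hessian of the value `a∘γ` at `g₀` is `q(γ′h, γ′h′) + λ₀(D²(Φ∘γ)(g₀)[h,h′])`, `q = a₂ − λ₀∘Φ₂`; with `γ′ = H₁ ∘ (Φ∘γ)′`
(`fderiv_criticalFamily_eq_linearisedMinimiser`) the first term is print's `⟨δB′, H₁*Δ₁H₁ δB′⟩`, and for a datum map affine in the parameter (print's `B′`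
itself) the second term vanishes. [cite: Balaban1989LargeFieldII, (1.12)–(1.13) p.359, (1.7) p.358; Balaban1985Variational, (81)–(82) p.290, (177) p.306] -/
theorem hessian_value_criticalFamily {a : E → ℝ} {Φ : E → V} {γ : G → E} {g₀ : G} {x₀ : E}
    (hγ₀ : γ g₀ = x₀) {γ' : G →L[ℝ] E} (hγ : HasFDerivAt γ γ' g₀) {γ₂ : G →L[ℝ] G →L[ℝ] E}
    (hγ₂ : HasFDerivAt (fun g => fderiv ℝ γ g) γ₂ g₀) (hγd : ∀ᶠ g in 𝓝 g₀, DifferentiableAt ℝ γ g)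
    {a₂ : E →L[ℝ] E →L[ℝ] ℝ} (ha₂ : HasFDerivAt (fun x => fderiv ℝ a x) a₂ x₀) (had : ∀ᶠ x in 𝓝 x₀, DifferentiableAt ℝ a x)
    {Φ₂ : E →L[ℝ] E →L[ℝ] V} (hΦ₂ : HasFDerivAt (fun x => fderiv ℝ Φ x) Φ₂ x₀) (hΦd : ∀ᶠ x in 𝓝 x₀, DifferentiableAt ℝ Φ x)
    {lam : V →L[ℝ] ℝ} (hlam : fderiv ℝ a x₀ = lam.comp (fderiv ℝ Φ x₀)) (h h' : G) :
    fderiv ℝ (fun g => fderiv ℝ (fun g => a (γ g)) g) g₀ h h'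
      = (a₂ (γ' h) (γ' h') - lam (Φ₂ (γ' h) (γ' h'))) + lam (fderiv ℝ (fun g => fderiv ℝ (fun g => Φ (γ g)) g) g₀ h h') := by
  rw [fderiv_fderiv_comp_apply hγ₀ hγ hγ₂ ha₂ hγd had, fderiv_fderiv_comp_apply hγ₀ hγ hγ₂ hΦ₂ hγd hΦd, hlam]
  simp only [ContinuousLinearMap.comp_apply, map_add]
  ring

/-! ### §1.6  Junction with the ray form of `Node00.CriticalOnFibreTangent` -/

/-- **RAY FORM ⇒ `fderiv` FORM**: if `a` is differentiable at `x` and `t ↦ a(x + t•X)` has derivative `0` at `t = 0` (the conclusion of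
`Node00.hasDerivAt_wilsonAction4_expChart_of_isCritOnFibre`, at `x = 0`), then `Da(x) X = 0` — the tangent-form criticality hypothesis of §1.2 at the
base member. [cite: Balaban1985Variational, (82)–(83) p.290] -/
theorem fderiv_apply_eq_zero_of_hasDerivAt_smul {a : E → ℝ} {x X : E} (ha : DifferentiableAt ℝ a x)
    (h : HasDerivAt (fun s : ℝ => a (x + s • X)) 0 0) : fderiv ℝ a x X = 0 := by
  have hline : HasDerivAt (fun s : ℝ => x + s • X) X 0 := by
    simpa using ((hasDerivAt_id (0 : ℝ)).smul_const X).const_add x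
  have h0 : x + (0 : ℝ) • X = x := by simp
  have ha' : HasFDerivAt a (fderiv ℝ a x) (x + (0 : ℝ) • X) := by rw [h0]; exact ha.hasFDerivAt
  have hcomp : HasDerivAt (fun s : ℝ => a (x + s • X)) (fderiv ℝ a x X) 0 := ha'.comp_hasDerivAt 0 hline
  exact hcomp.unique h

/-! ### §1.7 (v1.3)  Transfer across the uniqueness: bounds proved for ANY explicit operator with the two conditions hold for `H₁` (letter (c-1)) -/

omit [FiniteDimensional ℝ V] in
/-- **THE TWO CONDITIONS PIN THE OPERATOR AS A FUNCTION**: two maps satisfying [15] Sect. C's two linear conditions are EQUAL (funext of `linearisedMinimiser_unique`) —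
so print's explicit propagator formula ([10] (1.90) «𝒜_a = G̃⁻¹…», [B6] (2.35)) and the derivative of the minimiser family are the same object once the formula is
shown to satisfy the conditions. [cite: Balaban1985Variational, (45)–(47) p.285; Balaban1984PropagatorsI, (1.90)–(1.91) p.33] -/
theorem linearisedMinimiser_eq_of_conditions (L : E →L[ℝ] V) (q : E →L[ℝ] E →L[ℝ] ℝ)
    (hnd : ∀ d, L d = 0 → (∀ t, L t = 0 → q d t = 0) → d = 0) {H H' : V → E}
    (hLH : ∀ y, L (H y) = y) (hH : ∀ y t, L t = 0 → q (H y) t = 0)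
    (hLH' : ∀ y, L (H' y) = y) (hH' : ∀ y t, L t = 0 → q (H' y) t = 0) : H = H' :=
  funext fun y => linearisedMinimiser_unique L q hnd hLH hH hLH' hH' y

omit [FiniteDimensional ℝ V] in
/-- ★ **TRANSFER OF ANY PROPERTY (letter (c-1) of the N12 chain)**: whatever is proved about an explicitly exhibited operator `H′` with the two conditions — a kernel
majorant, exponential decay off `Λ` ([15] (190), [LF-II] p. 357 «replacing the minimizer … O(exp(−R_k))»), a norm bound — holds for EVERY `H` with the two conditions,
in particular for `H⁰_{1,k,Z}` = the derivative of the minimiser family (`fderiv_criticalFamily_eq_linearisedMinimiser`). [cite: Balaban1985Variational, (190) p.309, (45)–(47) p.285; Balaban1989LargeFieldII, p.357] -/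
theorem linearisedMinimiser_transfer (L : E →L[ℝ] V) (q : E →L[ℝ] E →L[ℝ] ℝ)
    (hnd : ∀ d, L d = 0 → (∀ t, L t = 0 → q d t = 0) → d = 0) {H H' : V → E}
    (hLH : ∀ y, L (H y) = y) (hH : ∀ y t, L t = 0 → q (H y) t = 0)
    (hLH' : ∀ y, L (H' y) = y) (hH' : ∀ y t, L t = 0 → q (H' y) t = 0)
    (P : (V → E) → Prop) (hP : P H') : P H := by
  rw [linearisedMinimiser_eq_of_conditions L q hnd hLH hH hLH' hH']
  exact hP

/-- **TRANSFER TO THE FAMILY'S VELOCITY**: a pointwise bound `‖H′ y‖ ≤ B y` for an explicit `H′` with the two conditions bounds the derivative of every differentiable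
fibre-critical family: `‖γ′ h‖ ≤ B (DΦ(x₀)(γ′ h))`. [cite: Balaban1985Variational, (177) p.306, (190) p.309; Balaban1989LargeFieldII, p.357] -/
theorem norm_fderiv_criticalFamily_le_of_bound {a : E → ℝ} {Φ : E → V} {γ : G → E} {g₀ : G} {x₀ : E}
    (hγ₀ : γ g₀ = x₀) {γ' : G →L[ℝ] E} (hγ : HasFDerivAt γ γ' g₀)
    {a₂ : E →L[ℝ] E →L[ℝ] ℝ} (ha₂ : HasFDerivAt (fun x => fderiv ℝ a x) a₂ x₀)
    {Φ₂ : E →L[ℝ] E →L[ℝ] V} (hΦ₂ : HasFDerivAt (fun x => fderiv ℝ Φ x) Φ₂ x₀)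
    (hsurj : Function.Surjective (fderiv ℝ Φ x₀))
    {lam : V →L[ℝ] ℝ} (hlam : fderiv ℝ a x₀ = lam.comp (fderiv ℝ Φ x₀))
    (hcrit : ∀ᶠ g in 𝓝 g₀, ∀ t, fderiv ℝ Φ (γ g) t = 0 → fderiv ℝ a (γ g) t = 0)
    (hnd : ∀ d, fderiv ℝ Φ x₀ d = 0 → (∀ t, fderiv ℝ Φ x₀ t = 0 → a₂ d t - lam (Φ₂ d t) = 0) → d = 0)
    {H' : V → E} (hLH' : ∀ y, fderiv ℝ Φ x₀ (H' y) = y)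
    (hH' : ∀ y t, fderiv ℝ Φ x₀ t = 0 → a₂ (H' y) t - lam (Φ₂ (H' y) t) = 0)
    {B : V → ℝ} (hB : ∀ y, ‖H' y‖ ≤ B y) (h : G) : ‖γ' h‖ ≤ B (fderiv ℝ Φ x₀ (γ' h)) := by
  rw [fderiv_criticalFamily_eq_linearisedMinimiser hγ₀ hγ ha₂ hΦ₂ hsurj hlam hcrit hnd hLH' hH' h]
  rw [hLH']
  exact hB _

omit [FiniteDimensional ℝ V] in
/-- ★ **ROBUST TRANSFER (approximate second condition)**: if the explicit `H′` reproduces the linearised datum EXACTLY (`L ∘ H′ = id`) but is `q`-orthogonal to `ker L`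
only up to `ε‖y‖‖t‖` (`ε ≥ 0`; a boundary layer, say), and `q` is COERCIVE on `ker L` with constant `c > 0`, then `H′` is `(ε∕c)‖y‖`-close to every exact solution `H`:
`‖H y − H′ y‖ ≤ (ε∕c)‖y‖` — the difference `d` lies in `ker L` and `c‖d‖² ≤ q(d,d) = −q(H′y, d) ≤ ε‖y‖‖d‖`.
[cite: Balaban1985Variational, (45)–(47) p.285, Sect. E p.300; Balaban1989LargeFieldII, (1.9) p.358, p.357] -/
theorem norm_sub_le_of_approx_conditions (L : E →L[ℝ] V) (q : E →L[ℝ] E →L[ℝ] ℝ) {c ε : ℝ} (hc : 0 < c) (hε : 0 ≤ ε)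
    (hcoer : ∀ t, L t = 0 → c * ‖t‖ ^ 2 ≤ q t t) {H H' : V → E}
    (hLH : ∀ y, L (H y) = y) (hH : ∀ y t, L t = 0 → q (H y) t = 0)
    (hLH' : ∀ y, L (H' y) = y) (hH' : ∀ y t, L t = 0 → |q (H' y) t| ≤ ε * ‖y‖ * ‖t‖) (y : V) :
    ‖H y - H' y‖ ≤ ε / c * ‖y‖ := by
  have hdker : L (H y - H' y) = 0 := by rw [map_sub, hLH, hLH', sub_self]
  have hqd : q (H y - H' y) (H y - H' y) = -(q (H' y) (H y - H' y)) := by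
    rw [show q (H y - H' y) = q (H y) - q (H' y) from map_sub q _ _, sub_apply, hH y _ hdker, zero_sub]
  have hkey : c * ‖H y - H' y‖ ^ 2 ≤ ε * ‖y‖ * ‖H y - H' y‖ := by
    have h1 := hcoer _ hdker
    have h2 : -(q (H' y) (H y - H' y)) ≤ |q (H' y) (H y - H' y)| := neg_le_abs _
    have h3 := hH' y _ hdker
    linarith
  by_cases hdz : H y - H' y = 0
  · rw [hdz, norm_zero]
    positivity
  · have hdpos : 0 < ‖H y - H' y‖ := norm_pos_iff.2 hdz
    have h4 : c * ‖H y - H' y‖ ≤ ε * ‖y‖ := by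
      have h5 : c * ‖H y - H' y‖ * ‖H y - H' y‖ ≤ ε * ‖y‖ * ‖H y - H' y‖ := by nlinarith [hkey]
      exact le_of_mul_le_mul_right h5 hdpos
    rw [div_mul_eq_mul_div, le_div_iff₀ hc]
    linarith

end Abstract

/-! ## §2  NODE 00 reading: the Wilson action along n07-e's exponential chart `expChart U₀ X = U₀·exp X` -/

section NodeZero

open T4Continuum
open T4AdjointCovarianceUnitary (lieSU expSU coe_expSU)
open Node00 (SU expChart coeField coeField_apply contDiff_coeField_expChart coe_expChart)
open scoped Matrix.Norms.L2Operator

variable {P : Params} {j : ℕ} {N : ℕ}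

/-- ★ **THE WILSON ACTION ALONG THE EXPONENTIAL CHART IS `C^ω`**: `X ↦ A(U₀·exp X) = Σ_p (1 − Re Tr(ABC⋆D⋆)∕N)` with `A, B, C, D` bond values of the
`C^ω` matrix field `coeField (expChart U₀ X)` (`Node00.contDiff_coeField_expChart`), the adjoint `⋆` real-linear continuous, `Re Tr ∕ N` real-linear.
[cite: Balaban1985Variational, (5) p.278, (15) p.280; Balaban1987RG1, (0.2) p.252] -/
theorem contDiff_wilsonAction4_expChart [NeZero N] (U₀ : GaugeField P j (SU N)) :
    ContDiff ℝ ⊤ (fun X : PBond P j → lieSU (Fin N) => wilsonAction4 (expChart U₀ X)) := by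
  have hF := contDiff_coeField_expChart U₀
  have hb : ∀ b : PBond P j, ContDiff ℝ ⊤ (fun X : PBond P j → lieSU (Fin N) => ((expChart U₀ X b : SU N) : Matrix (Fin N) (Fin N) ℂ)) :=
    fun b => contDiff_pi.1 hF b
  have hbs : ∀ b : PBond P j, ContDiff ℝ ⊤ (fun X : PBond P j → lieSU (Fin N) => star ((expChart U₀ X b : SU N) : Matrix (Fin N) (Fin N) ℂ)) :=
    fun b => ((starL' ℝ : Matrix (Fin N) (Fin N) ℂ ≃L[ℝ] Matrix (Fin N) (Fin N) ℂ).toContinuousLinearMap.contDiff).comp (hb b)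
  have hplaq : ∀ p : Plaq P j, ContDiff ℝ ⊤ (fun X : PBond P j → lieSU (Fin N) =>
      ((GaugeField.plaqHol (expChart U₀ X) p : SU N) : Matrix (Fin N) (Fin N) ℂ)) := by
    intro p
    simp only [Node00.coe_plaqHol_eq]
    exact (((hb _).mul (hb _)).mul (hbs _)).mul (hbs _)
  have htr : ContDiff ℝ ⊤ (fun M : Matrix (Fin N) (Fin N) ℂ => ((Matrix.traceLinearMap (Fin N) ℝ ℂ) M).re) :=
    Complex.reCLM.contDiff.comp (LinearMap.toContinuousLinearMap (Matrix.traceLinearMap (Fin N) ℝ ℂ)).contDiff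
  have hre : ∀ p : Plaq P j, ContDiff ℝ ⊤ (fun X : PBond P j → lieSU (Fin N) => reTr (GaugeField.plaqHol (expChart U₀ X) p)) := by
    intro p
    simp only [Node00.reTr_eq_traceLinearMap]
    exact (htr.comp (hplaq p)).div_const _
  unfold wilsonAction4 wilsonAction
  exact ContDiff.sum fun p _ => contDiff_const.mul (contDiff_const.sub (hre p))

/-- The lattice action along the chart has a second derivative at every point in the sense of §1 (`HasFDerivAt (fderiv a) (D²a X₀) X₀`), and is
differentiable everywhere. [cite: Balaban1985Variational, (5) p.278, (81) p.290 (bookkeeping)] -/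
theorem hasFDerivAt_fderiv_wilsonAction4_expChart [NeZero N] (U₀ : GaugeField P j (SU N)) (X₀ : PBond P j → lieSU (Fin N)) :
    HasFDerivAt (fun X => fderiv ℝ (fun X : PBond P j → lieSU (Fin N) => wilsonAction4 (expChart U₀ X)) X)
      (fderiv ℝ (fun X => fderiv ℝ (fun X : PBond P j → lieSU (Fin N) => wilsonAction4 (expChart U₀ X)) X) X₀) X₀ := by
  have h := (contDiff_wilsonAction4_expChart U₀).contDiffAt (x := X₀)
  have h1 := h.fderiv_right (m := 1) le_top
  exact (h1.differentiableAt one_ne_zero).hasFDerivAt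

/-- ★★★ **`H_{1,k}` AT THE LATTICE ACTION** — §1's `fderiv_criticalFamily_eq_linearisedMinimiser` for `a := X ↦ A(U₀·exp X)` on the chart space
`PBond P j → 𝔰𝔲(N)` of `Node00.CriticalOnFibreTangent`, ANY `C²` constraint chart `Ψ` (values in a finite-dimensional `V`; print: the averaging constraint
(3) ∕ [III] (2.12) read through the linearising transformation (47)) with ONTO derivative at the base member `X₀` (n07-e's submersion letter), the Lagrange
form `Da(X₀) = λ₀ ∘ DΨ(X₀)`, ANY family `g ↦ X g` of chart points differentiable at `g₀` with `X g₀ = X₀` and tangent-critical members near `g₀`, and the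
Lagrangian Hessian nondegenerate on `ker DΨ(X₀)` ([15] Sect. E ∕ [LF-II] (1.9), a letter): `X′(g₀)h = H₁(DΨ(X₀)(X′h))` for every `H₁` satisfying Sect. C's two
conditions.  With `U₀` the (2.12) minimiser of record and `Ψ` the canonical chart of `Node00.avOfRecord` (n07-e 35b–35d) this is [LF-II]'s `H_{1,k}`.
[cite: Balaban1985Variational, (174) p.305, (177) p.306, (182)–(183) p.307, (36)–(47) pp.283–285; Balaban1989LargeFieldII, (1.12)–(1.13) p.359; Balaban1988Convergent, (2.12) p.256] -/
theorem fderiv_criticalExpChartFamily_eq_linearisedMinimiser [NeZero N]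
    {V G : Type*} [NormedAddCommGroup V] [NormedSpace ℝ V] [FiniteDimensional ℝ V] [NormedAddCommGroup G] [NormedSpace ℝ G]
    (U₀ : GaugeField P j (SU N)) {Ψ : (PBond P j → lieSU (Fin N)) → V} {X : G → PBond P j → lieSU (Fin N)} {g₀ : G}
    {X₀ : PBond P j → lieSU (Fin N)} (hX₀ : X g₀ = X₀) {X' : G →L[ℝ] PBond P j → lieSU (Fin N)} (hX : HasFDerivAt X X' g₀)
    {Ψ₂ : (PBond P j → lieSU (Fin N)) →L[ℝ] (PBond P j → lieSU (Fin N)) →L[ℝ] V} (hΨ₂ : HasFDerivAt (fun Y => fderiv ℝ Ψ Y) Ψ₂ X₀)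
    (hsurj : Function.Surjective (fderiv ℝ Ψ X₀))
    {lam : V →L[ℝ] ℝ} (hlam : fderiv ℝ (fun Y => wilsonAction4 (expChart U₀ Y)) X₀ = lam.comp (fderiv ℝ Ψ X₀))
    (hcrit : ∀ᶠ g in 𝓝 g₀, ∀ t, fderiv ℝ Ψ (X g) t = 0 → fderiv ℝ (fun Y => wilsonAction4 (expChart U₀ Y)) (X g) t = 0)
    (hnd : ∀ d, fderiv ℝ Ψ X₀ d = 0 →
      (∀ t, fderiv ℝ Ψ X₀ t = 0 →
        fderiv ℝ (fun Y => fderiv ℝ (fun Y => wilsonAction4 (expChart U₀ Y)) Y) X₀ d t - lam (Ψ₂ d t) = 0) → d = 0)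
    {H : V → PBond P j → lieSU (Fin N)} (hLH : ∀ y, fderiv ℝ Ψ X₀ (H y) = y)
    (hH : ∀ y t, fderiv ℝ Ψ X₀ t = 0 →
      fderiv ℝ (fun Y => fderiv ℝ (fun Y => wilsonAction4 (expChart U₀ Y)) Y) X₀ (H y) t - lam (Ψ₂ (H y) t) = 0)
    (h : G) : X' h = H (fderiv ℝ Ψ X₀ (X' h)) :=
  fderiv_criticalFamily_eq_linearisedMinimiser hX₀ hX (hasFDerivAt_fderiv_wilsonAction4_expChart U₀ X₀) hΨ₂ hsurj hlam hcrit hnd hLH hH h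

/-- ★★ **THE SHAPE OF (1.12) AT THE LATTICE ACTION**: along any twice-differentiable family `g ↦ X g` of chart points through `X₀` with the Lagrange form
`Da(X₀) = λ₀ ∘ DΨ(X₀)` (`Ψ` differentiable near `X₀`), the Hessian of `g ↦ A(U₀·exp(X g))` at `g₀` is `q(X′h, X′h′) + λ₀(D²(Ψ∘X)(g₀)[h,h′])`,
`q = D²a(X₀) − λ₀∘Ψ₂` — print's `⟨δB′, H_{1,k}Δ₁H_{1,k}δB′⟩` once `X′ = H₁ ∘ (Ψ∘X)′`; for print's datum `B′` (affine datum map) the last term is `0`.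
[cite: Balaban1989LargeFieldII, (1.12)–(1.13) p.359, (1.7) p.358; Balaban1985Variational, (81)–(82) p.290, (177) p.306] -/
theorem hessian_wilsonAction4_criticalExpChartFamily [NeZero N]
    {V G : Type*} [NormedAddCommGroup V] [NormedSpace ℝ V] [FiniteDimensional ℝ V] [NormedAddCommGroup G] [NormedSpace ℝ G]
    (U₀ : GaugeField P j (SU N)) {Ψ : (PBond P j → lieSU (Fin N)) → V} {X : G → PBond P j → lieSU (Fin N)} {g₀ : G}
    {X₀ : PBond P j → lieSU (Fin N)} (hX₀ : X g₀ = X₀) {X' : G →L[ℝ] PBond P j → lieSU (Fin N)} (hX : HasFDerivAt X X' g₀)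
    {X₂ : G →L[ℝ] G →L[ℝ] PBond P j → lieSU (Fin N)} (hX₂ : HasFDerivAt (fun g => fderiv ℝ X g) X₂ g₀)
    (hXd : ∀ᶠ g in 𝓝 g₀, DifferentiableAt ℝ X g)
    {Ψ₂ : (PBond P j → lieSU (Fin N)) →L[ℝ] (PBond P j → lieSU (Fin N)) →L[ℝ] V} (hΨ₂ : HasFDerivAt (fun Y => fderiv ℝ Ψ Y) Ψ₂ X₀)
    (hΨd : ∀ᶠ Y in 𝓝 X₀, DifferentiableAt ℝ Ψ Y)
    {lam : V →L[ℝ] ℝ} (hlam : fderiv ℝ (fun Y => wilsonAction4 (expChart U₀ Y)) X₀ = lam.comp (fderiv ℝ Ψ X₀)) (h h' : G) :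
    fderiv ℝ (fun g => fderiv ℝ (fun g => wilsonAction4 (expChart U₀ (X g))) g) g₀ h h'
      = (fderiv ℝ (fun Y => fderiv ℝ (fun Y => wilsonAction4 (expChart U₀ Y)) Y) X₀ (X' h) (X' h') - lam (Ψ₂ (X' h) (X' h')))
        + lam (fderiv ℝ (fun g => fderiv ℝ (fun g => Ψ (X g)) g) g₀ h h') :=
  hessian_value_criticalFamily hX₀ hX hX₂ hXd (hasFDerivAt_fderiv_wilsonAction4_expChart U₀ X₀)
    (Filter.Eventually.of_forall fun Y => ((contDiff_wilsonAction4_expChart U₀).differentiable (by simp)).differentiableAt)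
    hΨ₂ hΨd hlam h h'

end NodeZero

/-! ## §3 (v1.1, append-only)  Junction with the predicates OF RECORD: n07-e's curve-criticality `Node00.IsCritOnFibre` and the (2.12) minimisers
over print's class (6) (`Node00.isCritOnFibre_of_isMinimizer_class6`) -/

section NodeZeroRecord

open T4Continuum B15DeterminingSets
open T4AdjointCovarianceUnitary (lieSU expSU coe_expSU)
open Node00
open scoped Matrix.Norms.L2Operator

variable {F : T4Family} {N : ℕ} [NeZero N]

/-- ★★ **CURVE-CRITICAL (OF RECORD) ⇒ TANGENT-CRITICAL AT A GENERAL CHART POINT** — the hypothesis `hcrit` of §1∕§2 from n07-e's predicate: if the member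
`U₀·exp X₁` is a critical configuration of (5) on the fibre `𝔅(𝐁, W)` in the CURVE form (`Node00.IsCritOnFibre`, the form n07-e derives from «(2.12) minimiser
over the open class (6)»), and `Ψ` is a chart of the constraint around `X₁` — strictly differentiable at `X₁` with ONTO derivative `Ψ′` and its level set
through `X₁` mapped by `expChart U₀` into that fibre — then `D(A∘expChart U₀)(X₁) t = 0` for every `t ∈ ker Ψ′` (print's (82) on (83), at a point of the
chart centred at `U₀` rather than at the member; the implicit-function curve of `Node00.exists_hasDerivAt_curve_of_mem_ker` through `X₁` with velocity `t`).
[cite: Balaban1985Variational, (82)–(83) p.290, (141) p.299, p.300, Sect. C (47) p.285; Balaban1988Convergent, (2.10)–(2.12) p.256] -/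
theorem fderiv_wilsonAction4_expChart_apply_eq_zero_of_isCritOnFibre {K : ℕ} {𝔹 : DetSet (F.P K)} {W : MSField (F.P K) (SU N)}
    (U₀ : GaugeField (F.P K) 0 (SU N)) {V : Type*} [NormedAddCommGroup V] [NormedSpace ℝ V] [FiniteDimensional ℝ V]
    {Ψ : (PBond (F.P K) 0 → lieSU (Fin N)) → V} {Ψ' : (PBond (F.P K) 0 → lieSU (Fin N)) →L[ℝ] V} {X₁ : PBond (F.P K) 0 → lieSU (Fin N)}
    (hΨ : HasStrictFDerivAt Ψ Ψ' X₁) (hon : (Ψ' : (PBond (F.P K) 0 → lieSU (Fin N)) →ₗ[ℝ] V).range = ⊤)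
    (hlev : ∀ Y, Ψ Y = Ψ X₁ → AgreeOn 𝔹 (avgFamily (avOfRecord F N K) (expChart U₀ Y)) W)
    (hcrit : IsCritOnFibre F N K 𝔹 W (expChart U₀ X₁)) {t : PBond (F.P K) 0 → lieSU (Fin N)} (ht : Ψ' t = 0) :
    fderiv ℝ (fun Y : PBond (F.P K) 0 → lieSU (Fin N) => wilsonAction4 (expChart U₀ Y)) X₁ t = 0 := by
  -- completeness of the (finite-dimensional) chart domain, for the pinned norm of `lieSU` (as in `Node00.CriticalOnFibreTangent`)
  haveI : @CompleteSpace (lieSU (Fin N)) (@PseudoMetricSpace.toUniformSpace _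
      (T4AdjointCovarianceUnitary.instSeminormedAddCommGroupLieSU (n := Fin N)).toPseudoMetricSpace) :=
    complete_of_proper
  obtain ⟨c, hc0, hct, hcf⟩ := exists_hasDerivAt_curve_of_mem_ker hΨ hon ht
  have hγ0 : (fun s => expChart U₀ (c s)) 0 = expChart U₀ X₁ := by
    show expChart U₀ (c 0) = expChart U₀ X₁
    rw [hc0]
  have hd : DifferentiableAt ℝ
      (fun (s : ℝ) (b : PBond (F.P K) 0) => (((fun s => expChart U₀ (c s)) s b : SU N) : Matrix (Fin N) (Fin N) ℂ)) 0 := by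
    have h1 : DifferentiableAt ℝ (fun Y : PBond (F.P K) 0 → lieSU (Fin N) => coeField (expChart U₀ Y)) (c 0) :=
      ((contDiff_coeField_expChart U₀).differentiable (by simp)).differentiableAt
    exact h1.comp (0 : ℝ) hct.differentiableAt
  have hfib : ∀ᶠ s in 𝓝 (0 : ℝ), AgreeOn 𝔹 (avgFamily (avOfRecord F N K) ((fun s => expChart U₀ (c s)) s)) W :=
    hcf.mono fun s hs => hlev (c s) hs
  have hA : DifferentiableAt ℝ (fun Y : PBond (F.P K) 0 → lieSU (Fin N) => wilsonAction4 (expChart U₀ Y)) X₁ :=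
    ((contDiff_wilsonAction4_expChart U₀).differentiable (by simp)).differentiableAt
  have hA' : HasFDerivAt (fun Y : PBond (F.P K) 0 → lieSU (Fin N) => wilsonAction4 (expChart U₀ Y))
      (fderiv ℝ (fun Y : PBond (F.P K) 0 → lieSU (Fin N) => wilsonAction4 (expChart U₀ Y)) X₁) (c 0) := by
    rw [hc0]; exact hA.hasFDerivAt
  have hcomp : HasDerivAt (fun s => wilsonAction4 ((fun s => expChart U₀ (c s)) s))
      (fderiv ℝ (fun Y : PBond (F.P K) 0 → lieSU (Fin N) => wilsonAction4 (expChart U₀ Y)) X₁ t) 0 :=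
    hA'.comp_hasDerivAt (0 : ℝ) hct
  exact hcrit (fun s => expChart U₀ (c s)) hγ0 hd hfib _ hcomp

/-- ★★★ **`H_{1,k}` FOR A DIFFERENTIABLE FAMILY OF (2.12) MINIMISERS OVER PRINT'S CLASS (6)** — U2b at the objects of record: let `g ↦ X g` be a family of
chart points, differentiable at `g₀` (`X g₀ = X₀`), whose members `U₀·exp(X g)` are MINIMISERS of (5) over the class (6)
`{(1.7) thresholds r_n on omegaPlaqs Ω n, n ≤ k} ∧ {(1.9) Sect2.CoDivClassOn Ω k ε}` on the fibres `𝔅(𝐁, W g)` of the averaging OF RECORD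
(`B15DeterminingSets.IsMinimizer (Node00.avOfRecord F N K) … 𝐁 (W g)` — [III] (2.12)), and let `Ψ` be a `C²` chart of the constraint with, near `g₀`, a strict
derivative at `X g` ONTO `V` whose level set through `X g` maps into `𝔅(𝐁, W g)` (n07-e's submersion letter, at every member).  With the Lagrange form
`D(A∘expChart U₀)(X₀) = λ₀ ∘ DΨ(X₀)` and the Lagrangian Hessian nondegenerate on `ker DΨ(X₀)` ([15] Sect. E ∕ [LF-II] (1.9)):
`X′(g₀)h = H₁(DΨ(X₀)(X′h))` for every `H₁` with [15] Sect. C's two conditions — «minimal ⇒ critical» is `Node00.isCritOnFibre_of_isMinimizer_class6`,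
curve ⇒ tangent form is the previous theorem, the rest is §1.
[cite: Balaban1985Variational, (5)–(6) p.278, (174) p.305, (177) p.306, (182)–(183) p.307, (36)–(47) pp.283–285, p.299; Balaban1985RegularSpaces, (1.7)–(1.9) p.77; Balaban1988Convergent, (2.12) p.256; Balaban1989LargeFieldII, (1.12)–(1.13) p.359] -/
theorem fderiv_minimiserExpChartFamily_eq_linearisedMinimiser_class6 {K k : ℕ} {Ω : ℕ → Set (Site (F.P K) 0)} {r : ℕ → ℝ} {ε : ℝ}
    {𝔹 : DetSet (F.P K)} (U₀ : GaugeField (F.P K) 0 (SU N))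
    {V G : Type*} [NormedAddCommGroup V] [NormedSpace ℝ V] [FiniteDimensional ℝ V] [NormedAddCommGroup G] [NormedSpace ℝ G]
    {W : G → MSField (F.P K) (SU N)} {Ψ : (PBond (F.P K) 0 → lieSU (Fin N)) → V} {X : G → PBond (F.P K) 0 → lieSU (Fin N)} {g₀ : G}
    {X₀ : PBond (F.P K) 0 → lieSU (Fin N)} (hX₀ : X g₀ = X₀) {X' : G →L[ℝ] PBond (F.P K) 0 → lieSU (Fin N)} (hX : HasFDerivAt X X' g₀)
    {Ψ₂ : (PBond (F.P K) 0 → lieSU (Fin N)) →L[ℝ] (PBond (F.P K) 0 → lieSU (Fin N)) →L[ℝ] V} (hΨ₂ : HasFDerivAt (fun Y => fderiv ℝ Ψ Y) Ψ₂ X₀)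
    (hsurj : Function.Surjective (fderiv ℝ Ψ X₀))
    {lam : V →L[ℝ] ℝ} (hlam : fderiv ℝ (fun Y => wilsonAction4 (expChart U₀ Y)) X₀ = lam.comp (fderiv ℝ Ψ X₀))
    (hmin : ∀ᶠ g in 𝓝 g₀, IsMinimizer (avOfRecord F N K)
      {U | (∀ n, n ≤ k → PlaqSmallOn (omegaPlaqs Ω n) (r n) U) ∧ Sect2.CoDivClassOn Ω k ε U} 𝔹 (W g) (expChart U₀ (X g)))
    (hchart : ∀ᶠ g in 𝓝 g₀, HasStrictFDerivAt Ψ (fderiv ℝ Ψ (X g)) (X g) ∧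
      ((fderiv ℝ Ψ (X g) : (PBond (F.P K) 0 → lieSU (Fin N)) →ₗ[ℝ] V).range = ⊤) ∧
      ∀ Y, Ψ Y = Ψ (X g) → AgreeOn 𝔹 (avgFamily (avOfRecord F N K) (expChart U₀ Y)) (W g))
    (hnd : ∀ d, fderiv ℝ Ψ X₀ d = 0 →
      (∀ t, fderiv ℝ Ψ X₀ t = 0 →
        fderiv ℝ (fun Y => fderiv ℝ (fun Y => wilsonAction4 (expChart U₀ Y)) Y) X₀ d t - lam (Ψ₂ d t) = 0) → d = 0)
    {H : V → PBond (F.P K) 0 → lieSU (Fin N)} (hLH : ∀ y, fderiv ℝ Ψ X₀ (H y) = y)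
    (hH : ∀ y t, fderiv ℝ Ψ X₀ t = 0 →
      fderiv ℝ (fun Y => fderiv ℝ (fun Y => wilsonAction4 (expChart U₀ Y)) Y) X₀ (H y) t - lam (Ψ₂ (H y) t) = 0)
    (h : G) : X' h = H (fderiv ℝ Ψ X₀ (X' h)) := by
  have hcrit : ∀ᶠ g in 𝓝 g₀, ∀ t, fderiv ℝ Ψ (X g) t = 0 →
      fderiv ℝ (fun Y : PBond (F.P K) 0 → lieSU (Fin N) => wilsonAction4 (expChart U₀ Y)) (X g) t = 0 := by
    filter_upwards [hmin, hchart] with g hm hc t ht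
    exact fderiv_wilsonAction4_expChart_apply_eq_zero_of_isCritOnFibre U₀ hc.1 hc.2.1 hc.2.2
      (isCritOnFibre_of_isMinimizer_class6 hm) ht
  exact fderiv_criticalExpChartFamily_eq_linearisedMinimiser U₀ hX₀ hX hΨ₂ hsurj hlam hcrit hnd hLH hH h

end NodeZeroRecord

/-! ## §4 (v1.1, append-only)  The UNCONSTRAINED-CRITICAL base point (`Da(x₀) = 0`; print's flat background `U₀ = 1`, the absolute minimum of (5)):
`λ₀ = 0`, the value Hessian is the bare pull-back `D²a(x₀)(γ′·, γ′·)`, and it is the MINIMUM of the second variation over the linearised fibre of the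
datum velocity — the shape of [LF-II] (1.7)'s left side `⟨B′, Δ_k B′⟩` with `Δ_k` DEFINED by the constrained minimisation [10] (1.65)–(1.66) -/

section UnconstrainedBase

variable {E V G : Type*} [NormedAddCommGroup E] [NormedSpace ℝ E]
  [NormedAddCommGroup V] [NormedSpace ℝ V] [FiniteDimensional ℝ V]
  [NormedAddCommGroup G] [NormedSpace ℝ G]

omit [FiniteDimensional ℝ V] in
/-- At an unconstrained critical base point the Lagrange form holds with the ZERO multiplier. [cite: Balaban1985Variational, (82) p.290, (170) p.305 (bookkeeping)] -/
theorem lagrangeForm_zero_of_fderiv_eq_zero {a : E → ℝ} (Φ : E → V) {x₀ : E} (h0 : fderiv ℝ a x₀ = 0) :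
    fderiv ℝ a x₀ = (0 : V →L[ℝ] ℝ).comp (fderiv ℝ Φ x₀) := by
  rw [h0, ContinuousLinearMap.zero_comp]

/-- **VALUE HESSIAN AT AN UNCONSTRAINED-CRITICAL BASE = THE BARE PULL-BACK** `D²(a∘γ)(g₀)[h,h′] = D²a(x₀)(γ′h, γ′h′)` — for ANY twice-differentiable family
`γ` through `x₀` (no constraint, no criticality of the members needed: the first-order term `Da(x₀)(γ₂ h h′)` is absent).  Print: at the flat background the
(1.12) expansion has no `J`-term and no constraint-curvature term; everything sits in `γ′ = H₁ ∘ (datum)′` (§1.3) and the second variation (U2a).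
[cite: Balaban1989LargeFieldII, (1.7) p.358, (1.12) p.359; Balaban1985Variational, (81)–(82) p.290] -/
theorem hessian_value_of_fderiv_eq_zero {a : E → ℝ} {γ : G → E} {g₀ : G} {x₀ : E}
    (hγ₀ : γ g₀ = x₀) {γ' : G →L[ℝ] E} (hγ : HasFDerivAt γ γ' g₀) {γ₂ : G →L[ℝ] G →L[ℝ] E}
    (hγ₂ : HasFDerivAt (fun g => fderiv ℝ γ g) γ₂ g₀) (hγd : ∀ᶠ g in 𝓝 g₀, DifferentiableAt ℝ γ g)
    {a₂ : E →L[ℝ] E →L[ℝ] ℝ} (ha₂ : HasFDerivAt (fun x => fderiv ℝ a x) a₂ x₀) (had : ∀ᶠ x in 𝓝 x₀, DifferentiableAt ℝ a x)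
    (h0 : fderiv ℝ a x₀ = 0) (h h' : G) :
    fderiv ℝ (fun g => fderiv ℝ (fun g => a (γ g)) g) g₀ h h' = a₂ (γ' h) (γ' h') := by
  rw [fderiv_fderiv_comp_apply hγ₀ hγ hγ₂ ha₂ hγd had, h0, zero_apply, zero_add]

/-- ★★ **AT AN UNCONSTRAINED-CRITICAL BASE, THE VALUE HESSIAN IS THE MINIMUM OF THE SECOND VARIATION OVER THE LINEARISED FIBRE OF THE DATUM VELOCITY**
([10] (1.65)–(1.66): `⟨B′, Δ_k B′⟩ = inf {⟨A, ΔA⟩ : Q_k A = B′}`; [LF-II] (1.7) left side at the flat background): if moreover the members of `γ` are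
tangent-critical on their fibres near `g₀`, `DΦ(x₀)` is onto, and `D²a(x₀)` is nonnegative on `ker DΦ(x₀)` (print: positive — the flat background is a
minimum), then `D²(a∘γ)(g₀)[h,h] = D²a(x₀)(γ′h, γ′h) ≤ D²a(x₀)(x, x)` for EVERY `x` with the same linearised datum `DΦ(x₀)x = DΦ(x₀)(γ′h)`.  Symmetry of
`D²a(x₀)` is Schwarz's theorem (Mathlib `second_derivative_symmetric_of_eventually`).
[cite: Balaban1984PropagatorsI, (1.65)–(1.66) p.33; Balaban1989LargeFieldII, (1.7) p.358, (1.12) p.359; Balaban1985Variational, (36)–(37) p.283, (82)–(83) p.290] -/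
theorem hessian_value_le_secondVariation_of_fderiv_eq_zero {a : E → ℝ} {Φ : E → V} {γ : G → E} {g₀ : G} {x₀ : E}
    (hγ₀ : γ g₀ = x₀) {γ' : G →L[ℝ] E} (hγ : HasFDerivAt γ γ' g₀) {γ₂ : G →L[ℝ] G →L[ℝ] E}
    (hγ₂ : HasFDerivAt (fun g => fderiv ℝ γ g) γ₂ g₀) (hγd : ∀ᶠ g in 𝓝 g₀, DifferentiableAt ℝ γ g)
    {a₂ : E →L[ℝ] E →L[ℝ] ℝ} (ha₂ : HasFDerivAt (fun x => fderiv ℝ a x) a₂ x₀) (had : ∀ᶠ x in 𝓝 x₀, DifferentiableAt ℝ a x)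
    (h0 : fderiv ℝ a x₀ = 0)
    {Φ₂ : E →L[ℝ] E →L[ℝ] V} (hΦ₂ : HasFDerivAt (fun x => fderiv ℝ Φ x) Φ₂ x₀)
    (hsurj : Function.Surjective (fderiv ℝ Φ x₀))
    (hcrit : ∀ᶠ g in 𝓝 g₀, ∀ t, fderiv ℝ Φ (γ g) t = 0 → fderiv ℝ a (γ g) t = 0)
    (hpos : ∀ t, fderiv ℝ Φ x₀ t = 0 → 0 ≤ a₂ t t) (h : G) {x : E} (hx : fderiv ℝ Φ x₀ x = fderiv ℝ Φ x₀ (γ' h)) :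
    fderiv ℝ (fun g => fderiv ℝ (fun g => a (γ g)) g) g₀ h h = a₂ (γ' h) (γ' h) ∧ a₂ (γ' h) (γ' h) ≤ a₂ x x := by
  refine ⟨hessian_value_of_fderiv_eq_zero hγ₀ hγ hγ₂ hγd ha₂ had h0 h h, ?_⟩
  have hsym : ∀ u v, a₂ u v = a₂ v u :=
    second_derivative_symmetric_of_eventually (had.mono fun x hx => hx.hasFDerivAt) ha₂
  have horth : ∀ t, fderiv ℝ Φ x₀ t = 0 → a₂ (γ' h) t = 0 := fun t ht => by
    have := lagrangeHessian_fderiv_apply_eq_zero hγ₀ hγ ha₂ hΦ₂ hsurj (lagrangeForm_zero_of_fderiv_eq_zero Φ h0) hcrit h ht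
    simpa using this
  exact linearisedMinimiser_isMinOn (fderiv ℝ Φ x₀) a₂ hsym hpos horth hx

/-- **SECOND-ORDER NECESSARY CONDITION: THE HESSIAN AT A LOCAL MINIMUM IS NONNEGATIVE** (`0 ≤ D²a(x₀)(t, t)` for every `t`; along the line `s ↦ x₀ + s•t`,
if the second derivative were `< 0` Mathlib's second-derivative test `isLocalMax_of_deriv_deriv_neg` would make `0` also a local maximum, the restriction would
be locally constant, and its second derivative `0`) — print: «This quadratic form is positive definite» at the minimiser ([LF-II] p. 357); used below to
DISCHARGE positivity at the flat background, the absolute minimum of (5). [cite: Balaban1989LargeFieldII, p.357, (1.9) p.358; Balaban1985Variational, Sect. E p.300] -/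
theorem hessian_nonneg_of_isLocalMin {a : E → ℝ} {x₀ : E} {a₂ : E →L[ℝ] E →L[ℝ] ℝ}
    (hmin : IsLocalMin a x₀) (had : ∀ᶠ x in 𝓝 x₀, DifferentiableAt ℝ a x)
    (ha₂ : HasFDerivAt (fun x => fderiv ℝ a x) a₂ x₀) (t : E) : 0 ≤ a₂ t t := by
  -- the line `s ↦ x₀ + s•t`
  have hline : ∀ s : ℝ, HasDerivAt (fun s : ℝ => x₀ + s • t) t s := fun s => by
    simpa using ((hasDerivAt_id s).smul_const t).const_add x₀
  have hline0 : (fun s : ℝ => x₀ + s • t) 0 = x₀ := by simp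
  have hcont : ContinuousAt (fun s : ℝ => x₀ + s • t) 0 := (hline 0).continuousAt
  set φ : ℝ → ℝ := fun s => a (x₀ + s • t) with hφ
  have hφmin : IsLocalMin φ 0 := by
    have hmin' : IsLocalMin a (x₀ + (0 : ℝ) • t) := by simpa using hmin
    exact IsLocalMin.comp_continuous (g := fun s : ℝ => x₀ + s • t) (b := 0) hmin' hcont
  -- `a` differentiable along the line near `s = 0`
  have hadl : ∀ᶠ s in 𝓝 (0 : ℝ), DifferentiableAt ℝ a (x₀ + s • t) := by
    have ht : Tendsto (fun s : ℝ => x₀ + s • t) (𝓝 0) (𝓝 x₀) := by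
      have h := hcont.tendsto
      simpa using h
    exact ht.eventually had
  have hφ' : ∀ᶠ s in 𝓝 (0 : ℝ), HasDerivAt φ (fderiv ℝ a (x₀ + s • t) t) s := by
    filter_upwards [hadl] with s hs
    exact hs.hasFDerivAt.comp_hasDerivAt s (hline s)
  have hderφ : deriv φ =ᶠ[𝓝 0] fun s => fderiv ℝ a (x₀ + s • t) t := hφ'.mono fun s hs => hs.deriv
  have hφc : ContinuousAt φ 0 := by
    have h0 : DifferentiableAt ℝ a (x₀ + (0 : ℝ) • t) := hadl.self_of_nhds
    exact (h0.hasFDerivAt.comp_hasDerivAt (0 : ℝ) (hline 0)).continuousAt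
  have hd1 : deriv φ 0 = 0 := by
    rw [hderφ.self_of_nhds]
    simp [hmin.fderiv_eq_zero]
  -- second derivative of `φ` at `0` is `a₂ t t`
  have hM : HasDerivAt (fun s : ℝ => fderiv ℝ a (x₀ + s • t)) (a₂ t) 0 := by
    have h1 : HasFDerivAt (fun x => fderiv ℝ a x) a₂ (x₀ + (0 : ℝ) • t) := by simpa using ha₂
    exact h1.comp_hasDerivAt (0 : ℝ) (hline 0)
  have hM' : HasDerivAt (fun s : ℝ => fderiv ℝ a (x₀ + s • t) t) (a₂ t t) 0 := by
    have := hM.clm_apply (hasDerivAt_const (0 : ℝ) t)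
    simpa using this
  have hd2 : HasDerivAt (deriv φ) (a₂ t t) 0 := hM'.congr_of_eventuallyEq hderφ
  -- one-variable second-order necessary condition: if `a₂ t t < 0`, Mathlib's second-derivative test makes `0` ALSO a local maximum of `φ`,
  -- so `φ` is locally constant, `deriv φ = 0` near `0`, and `a₂ t t = (deriv φ)′(0) = 0` — contradiction
  by_contra hneg
  rw [not_le] at hneg
  have hdd : deriv (deriv φ) 0 < 0 := by rw [hd2.deriv]; exact hneg
  have hmax : IsLocalMax φ 0 := isLocalMax_of_deriv_deriv_neg hdd hd1 hφc
  have hconst : ∀ᶠ s in 𝓝 (0 : ℝ), φ s = φ 0 := by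
    filter_upwards [hφmin, hmax] with s h1 h2 using le_antisymm h2 h1
  have hder : ∀ᶠ s in 𝓝 (0 : ℝ), deriv φ s = 0 := by
    filter_upwards [eventually_eventually_nhds.2 hconst] with s hs
    have hs' : φ =ᶠ[𝓝 s] fun _ => φ 0 := hs
    rw [hs'.deriv_eq, deriv_const]
  have hzero : HasDerivAt (deriv φ) 0 0 :=
    (hasDerivAt_const (0 : ℝ) (0 : ℝ)).congr_of_eventuallyEq (hder.mono fun s hs => hs)
  exact absurd (hd2.unique hzero) (ne_of_lt hneg)

/-- **SECOND DERIVATIVE ALONG A LINE = DIAGONAL OF THE FRÉCHET HESSIAN** (v1.2; the U2a ↔ U2b junction, abstract side): if `a` is differentiable near `x` and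
`Da` has derivative `a₂` at `x`, then `s ↦ a(x + s•v)` has second derivative `a₂ v v` at `s = 0` — so a second variation computed along rays (n12-w2's
`Node00.hasDerivAt_deriv_wilsonAction4_expChart`, [B9] (3.6)–(3.7)) IS the quadratic form of the Hessian this file's §1∕§4 speak about (`HasDerivAt.unique`).
[cite: Balaban1985BackgroundPropagators, (3.6)–(3.7) p.391; Balaban1989LargeFieldII, (1.12) p.359 (bookkeeping)] -/
theorem hasDerivAt_deriv_line {a : E → ℝ} {x : E} {a₂ : E →L[ℝ] E →L[ℝ] ℝ}
    (had : ∀ᶠ y in 𝓝 x, DifferentiableAt ℝ a y) (ha₂ : HasFDerivAt (fun y => fderiv ℝ a y) a₂ x) (v : E) :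
    HasDerivAt (deriv fun s : ℝ => a (x + s • v)) (a₂ v v) 0 := by
  have hline : ∀ s : ℝ, HasDerivAt (fun s : ℝ => x + s • v) v s := fun s => by
    simpa using ((hasDerivAt_id s).smul_const v).const_add x
  have hcont : ContinuousAt (fun s : ℝ => x + s • v) 0 := (hline 0).continuousAt
  have hadl : ∀ᶠ s in 𝓝 (0 : ℝ), DifferentiableAt ℝ a (x + s • v) := by
    have ht : Tendsto (fun s : ℝ => x + s • v) (𝓝 0) (𝓝 x) := by
      have h := hcont.tendsto
      simpa using h
    exact ht.eventually had
  have hderφ : (deriv fun s : ℝ => a (x + s • v)) =ᶠ[𝓝 0] fun s => fderiv ℝ a (x + s • v) v := by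
    filter_upwards [hadl] with s hs
    exact (hs.hasFDerivAt.comp_hasDerivAt s (hline s)).deriv
  have hM : HasDerivAt (fun s : ℝ => fderiv ℝ a (x + s • v)) (a₂ v) 0 := by
    have h1 : HasFDerivAt (fun y => fderiv ℝ a y) a₂ (x + (0 : ℝ) • v) := by simpa using ha₂
    exact h1.comp_hasDerivAt (0 : ℝ) (hline 0)
  have hM' : HasDerivAt (fun s : ℝ => fderiv ℝ a (x + s • v) v) (a₂ v v) 0 := by
    have := hM.clm_apply (hasDerivAt_const (0 : ℝ) v)
    simpa using this
  exact hM'.congr_of_eventuallyEq hderφ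

/-- The same through the origin: `s ↦ a(s•v)` has second derivative `D²a(0)(v, v)` at `0`. [cite: Balaban1985BackgroundPropagators, (3.6)–(3.7) p.391 (bookkeeping)] -/
theorem hasDerivAt_deriv_smul {a : E → ℝ} {a₂ : E →L[ℝ] E →L[ℝ] ℝ}
    (had : ∀ᶠ y in 𝓝 (0 : E), DifferentiableAt ℝ a y) (ha₂ : HasFDerivAt (fun y => fderiv ℝ a y) a₂ 0) (v : E) :
    HasDerivAt (deriv fun s : ℝ => a (s • v)) (a₂ v v) 0 := by
  have h := hasDerivAt_deriv_line had ha₂ v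
  simpa using h

end UnconstrainedBase

section NodeZeroFlat

open T4Continuum B15DeterminingSets
open T4AdjointCovarianceUnitary (lieSU expSU coe_expSU)
open Node00
open scoped Matrix.Norms.L2Operator

variable {P : Params} {j : ℕ} {N : ℕ} [NeZero N]

/-- **THE FLAT BACKGROUND IS THE ABSOLUTE MINIMUM OF (5) ALONG THE CHART**: `0` is a (local, indeed global) minimum of `Y ↦ A(1·exp Y)` — the unit
configuration has action `0` (`1(∂p) = 1`, `Re tr 1 = 1`) and `A ≥ 0` (`wilsonAction4_nonneg`).
[cite: Balaban1987RG1, (0.2) p.252; Balaban1989LargeFieldII, p.357 («the background field identically equal to 1»)] -/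
theorem isLocalMin_wilsonAction4_expChart_one :
    IsLocalMin (fun Y : PBond P j → lieSU (Fin N) => wilsonAction4 (expChart (1 : GaugeField P j (SU N)) Y)) 0 := by
  have hA1 : wilsonAction4 (expChart (1 : GaugeField P j (SU N)) 0) = 0 := by
    rw [expChart_zero]
    unfold wilsonAction4 wilsonAction
    refine Finset.sum_eq_zero fun p _ => ?_
    have hp : GaugeField.plaqHol (1 : GaugeField P j (SU N)) p = 1 := by
      unfold GaugeField.plaqHol
      show (1 : SU N) * 1 * (1 : SU N)⁻¹ * (1 : SU N)⁻¹ = 1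
      simp
    rw [hp, GaugeGroup.reTr_one]
    ring
  exact Filter.Eventually.of_forall fun Y => by
    show wilsonAction4 (expChart (1 : GaugeField P j (SU N)) 0) ≤ wilsonAction4 (expChart 1 Y)
    rw [hA1]
    exact wilsonAction4_nonneg _

/-- **THE FLAT BACKGROUND IS AN UNCONSTRAINED CRITICAL POINT OF (5)**: `D(A∘expChart 1)(0) = 0` (Fermat at the minimum, Mathlib `IsLocalMin.fderiv_eq_zero`).
[cite: Balaban1987RG1, (0.2) p.252; Balaban1989LargeFieldII, p.357] -/
theorem fderiv_wilsonAction4_expChart_one_eq_zero :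
    fderiv ℝ (fun Y : PBond P j → lieSU (Fin N) => wilsonAction4 (expChart (1 : GaugeField P j (SU N)) Y)) 0 = 0 :=
  isLocalMin_wilsonAction4_expChart_one.fderiv_eq_zero

/-- **THE SECOND VARIATION OF (5) AT THE FLAT BACKGROUND IS NONNEGATIVE** — `0 ≤ D²(A∘expChart 1)(0)(t, t)` for every Lie-algebra field `t` (print: positive
definite up to gauge directions; here the order-two consequence of `1` being the minimum, by `hessian_nonneg_of_isLocalMin`).
[cite: Balaban1989LargeFieldII, p.357, (1.9) p.358; Balaban1987RG1, (0.2) p.252] -/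
theorem secondVariation_wilsonAction4_expChart_one_nonneg (t : PBond P j → lieSU (Fin N)) :
    0 ≤ fderiv ℝ (fun Y => fderiv ℝ (fun Y : PBond P j → lieSU (Fin N) => wilsonAction4 (expChart (1 : GaugeField P j (SU N)) Y)) Y) 0 t t :=
  hessian_nonneg_of_isLocalMin isLocalMin_wilsonAction4_expChart_one
    (Filter.Eventually.of_forall fun Y => ((contDiff_wilsonAction4_expChart (1 : GaugeField P j (SU N))).differentiable (by simp)).differentiableAt)
    (hasFDerivAt_fderiv_wilsonAction4_expChart 1 0) t

/-- ★★★ **[LF-II] (1.7)'s LEFT SIDE IN KERNEL SHAPE AT THE FLAT BACKGROUND**: for ANY twice-differentiable family `g ↦ X g` of chart points through `0` at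
`U₀ = 1` whose members are tangent-critical on their fibres (near `g₀`) for a `C²` constraint chart `Ψ` with onto `DΨ(0)`, the Hessian of the value
`g ↦ A(1·exp(X g))` at `g₀` in a direction `h` is the SECOND VARIATION OF THE WILSON ACTION AT `1` (U2a, `D²(A∘expChart 1)(0)`) on the velocity `X′h` (U2b:
`= H₁((Ψ∘X)′h)`, §1.3 ∕ §3), AND it is the MINIMUM of that second variation over all fine fields `x` with the same linearised datum `DΨ(0)x = DΨ(0)(X′h)` —
[10] (1.65)–(1.66)'s `⟨B′, Δ_k B′⟩`, the object [LF-II] (1.7) bounds below by `γ₀⟨B′, Δ_k B′⟩ − O(1)ε_k|B′|²`.  No positivity hypothesis: the second variation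
at `1` is nonnegative because `1` is the minimum (`secondVariation_wilsonAction4_expChart_one_nonneg`).
[cite: Balaban1989LargeFieldII, (1.7) p.358, (1.12) p.359; Balaban1984PropagatorsI, (1.65)–(1.66) p.33; Balaban1985Variational, (36)–(37) p.283, (82)–(83) p.290] -/
theorem hessian_wilsonAction4_flat_expChartFamily
    {V G : Type*} [NormedAddCommGroup V] [NormedSpace ℝ V] [FiniteDimensional ℝ V] [NormedAddCommGroup G] [NormedSpace ℝ G]
    {Ψ : (PBond P j → lieSU (Fin N)) → V} {X : G → PBond P j → lieSU (Fin N)} {g₀ : G}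
    (hX₀ : X g₀ = 0) {X' : G →L[ℝ] PBond P j → lieSU (Fin N)} (hX : HasFDerivAt X X' g₀)
    {X₂ : G →L[ℝ] G →L[ℝ] PBond P j → lieSU (Fin N)} (hX₂ : HasFDerivAt (fun g => fderiv ℝ X g) X₂ g₀)
    (hXd : ∀ᶠ g in 𝓝 g₀, DifferentiableAt ℝ X g)
    {Ψ₂ : (PBond P j → lieSU (Fin N)) →L[ℝ] (PBond P j → lieSU (Fin N)) →L[ℝ] V} (hΨ₂ : HasFDerivAt (fun Y => fderiv ℝ Ψ Y) Ψ₂ 0)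
    (hsurj : Function.Surjective (fderiv ℝ Ψ 0))
    (hcrit : ∀ᶠ g in 𝓝 g₀, ∀ t, fderiv ℝ Ψ (X g) t = 0 →
      fderiv ℝ (fun Y : PBond P j → lieSU (Fin N) => wilsonAction4 (expChart (1 : GaugeField P j (SU N)) Y)) (X g) t = 0)
    (h : G) {x : PBond P j → lieSU (Fin N)} (hx : fderiv ℝ Ψ 0 x = fderiv ℝ Ψ 0 (X' h)) :
    fderiv ℝ (fun g => fderiv ℝ (fun g => wilsonAction4 (expChart (1 : GaugeField P j (SU N)) (X g))) g) g₀ h h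
        = fderiv ℝ (fun Y => fderiv ℝ (fun Y : PBond P j → lieSU (Fin N) => wilsonAction4 (expChart (1 : GaugeField P j (SU N)) Y)) Y) 0
            (X' h) (X' h) ∧
      fderiv ℝ (fun Y => fderiv ℝ (fun Y : PBond P j → lieSU (Fin N) => wilsonAction4 (expChart (1 : GaugeField P j (SU N)) Y)) Y) 0
            (X' h) (X' h)
        ≤ fderiv ℝ (fun Y => fderiv ℝ (fun Y : PBond P j → lieSU (Fin N) => wilsonAction4 (expChart (1 : GaugeField P j (SU N)) Y)) Y) 0 x x :=
  hessian_value_le_secondVariation_of_fderiv_eq_zero hX₀ hX hX₂ hXd (hasFDerivAt_fderiv_wilsonAction4_expChart 1 0)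
    (Filter.Eventually.of_forall fun Y => ((contDiff_wilsonAction4_expChart (1 : GaugeField P j (SU N))).differentiable (by simp)).differentiableAt)
    fderiv_wilsonAction4_expChart_one_eq_zero hΨ₂ hsurj hcrit (fun t _ => secondVariation_wilsonAction4_expChart_one_nonneg t) h hx

/-- **THE FIRST CONJUNCT ALONE (v1.2, ref-M READ-11 NIT 2)**: for ANY twice-differentiable chart family `X` through `0` at the flat background — no constraint, no
criticality, no chart — the value Hessian is the second variation on the velocity: `D²(A∘expChart 1∘X)(g₀)[h,h′] = D²(A∘expChart 1)(0)(X′h, X′h′)`.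
[cite: Balaban1989LargeFieldII, (1.7) p.358, (1.12) p.359; Balaban1985Variational, (81)–(82) p.290] -/
theorem hessian_wilsonAction4_flat_eq_secondVariation
    {G : Type*} [NormedAddCommGroup G] [NormedSpace ℝ G] {X : G → PBond P j → lieSU (Fin N)} {g₀ : G}
    (hX₀ : X g₀ = 0) {X' : G →L[ℝ] PBond P j → lieSU (Fin N)} (hX : HasFDerivAt X X' g₀)
    {X₂ : G →L[ℝ] G →L[ℝ] PBond P j → lieSU (Fin N)} (hX₂ : HasFDerivAt (fun g => fderiv ℝ X g) X₂ g₀)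
    (hXd : ∀ᶠ g in 𝓝 g₀, DifferentiableAt ℝ X g) (h h' : G) :
    fderiv ℝ (fun g => fderiv ℝ (fun g => wilsonAction4 (expChart (1 : GaugeField P j (SU N)) (X g))) g) g₀ h h'
      = fderiv ℝ (fun Y => fderiv ℝ (fun Y : PBond P j → lieSU (Fin N) => wilsonAction4 (expChart (1 : GaugeField P j (SU N)) Y)) Y) 0
          (X' h) (X' h') :=
  hessian_value_of_fderiv_eq_zero hX₀ hX hX₂ hXd (hasFDerivAt_fderiv_wilsonAction4_expChart 1 0)
    (Filter.Eventually.of_forall fun Y => ((contDiff_wilsonAction4_expChart (1 : GaugeField P j (SU N))).differentiable (by simp)).differentiableAt)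
    fderiv_wilsonAction4_expChart_one_eq_zero h h'

/-- ★★ **U2a ↔ U2b JUNCTION AT THE LATTICE ACTION (v1.2)**: the second derivative of the Wilson action along the ray `s ↦ U₀·e^{sX}` at `s = 0` (n12-w2's second
variation, `Node00.hasDerivAt_deriv_wilsonAction4_expChart U₀ X`, [B9] (3.6)–(3.7) with `U(∂p)` exact) IS the diagonal value `D²(A∘expChart U₀)(0)(X, X)` of the
Hessian entering §1–§4 (`q = a₂ − λ₀∘Φ₂` with `a₂ = D²(A∘expChart U₀)(0)`); the printed trace formula follows by `HasDerivAt.unique` with that theorem (not restated here).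
[cite: Balaban1985BackgroundPropagators, (3.6)–(3.7) p.391; Balaban1989LargeFieldII, (1.12) p.359; Balaban1985Variational, (81)–(82) p.290] -/
theorem hasDerivAt_deriv_wilsonAction4_expChart_smul_fderiv (U₀ : GaugeField P j (SU N)) (X : PBond P j → lieSU (Fin N)) :
    HasDerivAt (deriv fun s : ℝ => wilsonAction4 (expChart U₀ (s • X)))
      (fderiv ℝ (fun Y => fderiv ℝ (fun Y : PBond P j → lieSU (Fin N) => wilsonAction4 (expChart U₀ Y)) Y) 0 X X) 0 :=
  hasDerivAt_deriv_smul
    (Filter.Eventually.of_forall fun Y => ((contDiff_wilsonAction4_expChart U₀).differentiable (by simp)).differentiableAt)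
    (hasFDerivAt_fderiv_wilsonAction4_expChart U₀ 0) X

/-- The junction as an equality of numbers: `deriv (deriv (s ↦ A(U₀·e^{sX}))) 0 = D²(A∘expChart U₀)(0)(X, X)`. [cite: Balaban1985BackgroundPropagators, (3.6)–(3.7) p.391 (bookkeeping)] -/
theorem deriv_deriv_wilsonAction4_expChart_smul_eq (U₀ : GaugeField P j (SU N)) (X : PBond P j → lieSU (Fin N)) :
    deriv (deriv fun s : ℝ => wilsonAction4 (expChart U₀ (s • X))) 0
      = fderiv ℝ (fun Y => fderiv ℝ (fun Y : PBond P j → lieSU (Fin N) => wilsonAction4 (expChart U₀ Y)) Y) 0 X X :=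
  (hasDerivAt_deriv_wilsonAction4_expChart_smul_fderiv U₀ X).deriv

/-- ★★ **`H⁰_{1,k}` AT THE FLAT BACKGROUND (v1.2)**: with `λ₀ = 0` discharged (`fderiv_wilsonAction4_expChart_one_eq_zero`), the derivative of ANY differentiable
family of chart points through `0` at `U₀ = 1` with tangent-critical members is `H ∘ DΨ(0) ∘ X′` for EVERY map `H` satisfying [15] Sect. C's two FLAT conditions —
`DΨ(0)(H y) = y` (reproduces the linearised datum; w4's «`Q_k(H⁰B′) = B′`») and `D²(A∘expChart 1)(0)(H y, t) = 0` on `ker DΨ(0)` (flat second variation, U2a) —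
as soon as the flat second variation is NONDEGENERATE on `ker DΨ(0)` (gauge directions excluded by the chart `Ψ`, print's (83) `RD*δA′ = 0`).  By
`linearisedMinimiser_unique` any explicit propagator-built operator with these two properties ([10] (1.90)-type `G Q*(…)`-built operators) IS this `H`, so its kernel bounds
(decay, [10] Prop. 1.1) transfer to the derivative of the family — the structural half of [LF-II] p. 357's replacement steps.
[cite: Balaban1985Variational, (36)–(47) pp.283–285, (83) p.290, (174) p.305, (177) p.306; Balaban1984PropagatorsI, (1.64)–(1.66) p.29, (1.90)–(1.91) p.33; Balaban1989LargeFieldII, p.357, (1.12) p.359] -/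
theorem fderiv_flatCriticalExpChartFamily_eq
    {V G : Type*} [NormedAddCommGroup V] [NormedSpace ℝ V] [FiniteDimensional ℝ V] [NormedAddCommGroup G] [NormedSpace ℝ G]
    {Ψ : (PBond P j → lieSU (Fin N)) → V} {X : G → PBond P j → lieSU (Fin N)} {g₀ : G}
    (hX₀ : X g₀ = 0) {X' : G →L[ℝ] PBond P j → lieSU (Fin N)} (hX : HasFDerivAt X X' g₀)
    {Ψ₂ : (PBond P j → lieSU (Fin N)) →L[ℝ] (PBond P j → lieSU (Fin N)) →L[ℝ] V} (hΨ₂ : HasFDerivAt (fun Y => fderiv ℝ Ψ Y) Ψ₂ 0)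
    (hsurj : Function.Surjective (fderiv ℝ Ψ 0))
    (hcrit : ∀ᶠ g in 𝓝 g₀, ∀ t, fderiv ℝ Ψ (X g) t = 0 →
      fderiv ℝ (fun Y : PBond P j → lieSU (Fin N) => wilsonAction4 (expChart (1 : GaugeField P j (SU N)) Y)) (X g) t = 0)
    (hnd : ∀ d, fderiv ℝ Ψ 0 d = 0 →
      (∀ t, fderiv ℝ Ψ 0 t = 0 →
        fderiv ℝ (fun Y => fderiv ℝ (fun Y : PBond P j → lieSU (Fin N) => wilsonAction4 (expChart (1 : GaugeField P j (SU N)) Y)) Y) 0 d t = 0) →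
      d = 0)
    {H : V → PBond P j → lieSU (Fin N)} (hLH : ∀ y, fderiv ℝ Ψ 0 (H y) = y)
    (hH : ∀ y t, fderiv ℝ Ψ 0 t = 0 →
      fderiv ℝ (fun Y => fderiv ℝ (fun Y : PBond P j → lieSU (Fin N) => wilsonAction4 (expChart (1 : GaugeField P j (SU N)) Y)) Y) 0 (H y) t = 0)
    (h : G) : X' h = H (fderiv ℝ Ψ 0 (X' h)) := by
  refine fderiv_criticalExpChartFamily_eq_linearisedMinimiser (1 : GaugeField P j (SU N)) hX₀ hX hΨ₂ hsurj
    (lagrangeForm_zero_of_fderiv_eq_zero Ψ fderiv_wilsonAction4_expChart_one_eq_zero) hcrit (fun d hd hq => hnd d hd fun t ht => ?_)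
    hLH (fun y t ht => ?_) h
  · have := hq t ht
    simpa using this
  · simpa using hH y t ht

end NodeZeroFlat

end Literature.MathematicalPhysics.QuantumFieldTheory.Balaban1983to89.B11Eq177CriticalFamilyDerivative

end
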